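import Mathlib
import HarnessLib
import Literature.Combinatorics.Additive.RectificationOfSmallSets
import Literature.Combinatorics.Additive.HamidouneRodsethRuns
import Literature.Combinatorics.Additive.HamidouneRodsethAbelianPairs

/-!
# Hamidoune–Serra–Zémor 2006, §3 «Compression transfer»: Theorem 10, with the `ℤ`
# two-above-critical lemma (Lemma 9), the rectification step (Lemma 11) and the missing-point
# accounting of Lemmas 12–13

Topic `Literature/Combinatorics/Additive`.  Cell `mm-stpp` (D-0046), seat `mm-stpp-lit` (gen 18);
census-silent Literature shelf.  Companion of `IsoperimetricMethod.lean` (which holds §2 of the same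
paper: Theorem 7 for every defect `m` and Proposition 8), `RectificationOfSmallSets.lean`
(`Rectification.almostAP_pair_int`, the ONE-above analogue of Lemma 9 below, and the `apFinset`
transfer lemmas), `LevSmeliansky.lean` (`lev_smeliansky_inverse` = Nathanson's Theorem 4.8, the
paper's Theorem 1) and `HamidouneRodsethRuns.lean` (runs and components in `ℤ/pℤ`).

## Source (read at the page this session)

Y. O. Hamidoune, O. Serra, G. Zémor, *On the critical pair theory in `ℤ/pℤ`*, Acta Arith. 121
(2006) 99–115 = arXiv:math/0507561 — held twice: `paper:arxiv-math_0507561` (LaTeX source, chunks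
p0001–p0012, all read) and `paper:doi-10-4064-aa121-2-1` (publisher text, pp. 99–115; §3 =
pp. 104–107 re-read against the arXiv text: identical statements).  The paper's main result
(Theorem 3: `|A| ≥ 4`, `|B| ≥ 5`, `p ≥ 53`, `|A + B| ≤ |A| + |B| + 1 ≤ p − 5` ⇒ `ℓ_r(A) ≤ |A| + 2`
and `ℓ_r(B) ≤ |B| + 2` for some `r`) is the case `m = 1` of their Conjecture 1; §3 is the first of
its four ingredients («Step 1: prove a special case of Conjecture 1 assuming that one of the two sets
is already known to be contained in a short arithmetic progression»).

## What is here (all PROVED; no `sorry`, no named facts)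

* **Lemma 9** (p. 104–105, the `ℤ` counterpart): `CompressionTransfer.subset_apFinset_pair_int_min'`
  (with the minima as first terms, by the printed induction on `|B|`) and the symmetric packaged
  form `CompressionTransfer.subset_apFinset_pair_int`: `A, B ⊂ ℤ`, `|A|, |B| ≥ 4`,
  `max(|A|,|B|) ≥ 5`, `|A + B| ≤ |A| + |B| + 1` ⇒ `A ⊆ {a + i d : i ≤ |A| + 1}`,
  `B ⊆ {b + j d : j ≤ |B| + 1}` for ONE `d > 0`.
* **Lemma 11** (p. 106: «`X + Y` can really be considered as a sum in `ℤ`»), as the transfer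
  statement `CompressionTransfer.subset_apFinset_of_short_runs`: in `ℤ/pℤ`, if `U` lies in a
  `d`-progression with `M` terms and `V` in one with `L ≤ |V| + 2` terms, `M + L ≤ p + 1`,
  `|U|, |V| ≥ 4`, `max ≥ 5`, `|U + V| ≤ |U| + |V| + 1`, then `U` lies in a `d`-progression with
  `|U| + 2` terms (lift = `CompressionTransfer.lift`, with `card_lift`, `card_lift_add_lift`).
* **Lemmas 12 and 13 in quantitative form** (pp. 106–107), for a pair `(U, V)` with
  `V ⊆ {0, d, …, (L−1)d} ∋ 0, (L−1)d`, `L ≤ |V| + 2`, `|U + V| ≤ |U| + |V| + 1`, in the situation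
  of the paper's standing assumption «`|C_j| < ℓ(Y) − 1`» (every `d`-progression with `L − 1` terms
  meets `U`): `CompressionTransfer.false_of_one_hole` (one hole `η` in `V`: impossible as soon as the
  number `D` of missing points `ℤ/pℤ ∖ (U + V)` is `≥ 11`, or `L ≥ 17` and `D ≥ 5`) and
  `CompressionTransfer.false_of_two_holes` (two holes: same thresholds), over the device
  `backDist` / `pred_mem` / `eq_of_window_meet` / `sum_pred_eq` / `sum_card_windows_le`
  (predecessor of a missing point along `−d`, disjoint windows, telescoping) and the per-point
  inequality `step_ineq` (a discharging potential); packaged as `false_of_runs_meet`, with the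
  corollaries `card_lt_of_runs_meet` and `not_three_consecutive_missing` (display (6): missing
  points come in blocks of length `≤ 2`).
* **Theorem 10** (p. 105: «Let `X`, `Y` be subsets of `ℤ/pℤ` such that
  `|X + Y| = |X| + |Y| + 1 ≤ p − 5`, and with `|Y| ≥ 4`, `|X| ≥ 5`.  If `p > 32` then
  `ℓ_1(Y) ≤ |Y| + 2` implies `ℓ_1(X) ≤ |X| + 2`»): `CompressionTransfer.compression_transfer`
  (general step `d ≠ 0`, and `|X + Y| ≤ |X| + |Y| + 1`), through the hull-normalised form
  `CompressionTransfer.compression_transfer_normalised` (`Y ⊆ {0, d, …, (L−1)d}` with both ends in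
  `Y`; reduction by `exists_tight_apFinset` and a translation).  Its proof is the printed case
  analysis: Lemma 11 when `X` misses a whole `(L−1)`-term run; otherwise Lemmas 12–13
  (`false_of_runs_meet`) unless there are at most `10` missing points and `L ≤ 16`, and in that
  residual regime the set `S` of missing points and the reflection `N = (L−1)d − Y` of `Y`
  (`exists_reflection`) have `S + N` inside a translate of the complement of `X`, whence
  `|S| + |N| − 1 ≤ |S + N| ≤ |S| + |N| + 1` and one of Vosper's theorem (`vosper_inverse`), the
  Hamidoune–Rødseth theorem (`Isoperimetric.hamidouneRodseth_inverse_theorem`) or — the paper's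
  «dual» pair — Lemmas 11–13 for `(S, N)` applies; the common difference it produces is `±d`
  (`eq_or_eq_neg_of_two_progressions`), and `S` in a short `d`-progression contradicts
  `not_three_consecutive_missing` (via `exists_three_terms`) or the final count
  `card_le_two_mul_card_inter`.

## Deviations from print (also flagged in the docstrings)

* Lemma 9: the normalisation `0 ∈ A ∩ B`, `gcd(A) = gcd(B) = 1` is replaced by carrying the
  common difference `d > 0` (first terms `min A`, `min B`); in the inductive step the two
  differences obtained for `B` and `B ∖ {max B}` are identified by a divisibility count (two of the
  `|B| − 1 ≥ 5` points are consecutive in each progression) — the printed text does this silently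
  through `gcd = 1`.  Theorem 1 (Lev–Smeliansky) enters through `lev_smeliansky_inverse`.
* Lemmas 12–13: the paper counts, for each connected component `C_i` of the complement of `X`, the
  points of `C_i` missed by `X + Y` (displays (4)–(6)) and sums; we count per MISSING POINT `z`
  instead (its predecessor `z − t d` among the missing points, and the `min(t, L)` points of its
  window, of which all but the `≤ 2` «hole translates» lie outside `X`), which is the same mechanism
  (deficient gaps are preceded by `X`-runs of length `≤ 2`) with bookkeeping that needs no cyclic
  order on components.  The two-hole count is organised as a discharging (potential) argument; its
  thresholds are `D ≥ 11` missing points or `L = ℓ(Y) ≥ 17`, where the paper uses `|Y| ≥ 10` or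
  `≥ 12` missing points — numerically different cut-offs for the same dichotomy, chosen so that the
  small residual case is the one `p > 32` makes dual-tractable.  Everything is stated for
  `|X + Y| ≤ |X| + |Y| + 1` (the paper writes `=`; its final duality step applies Lemma 13 to a pair
  for which only `≤` is available).
* Theorem 10, final step: the paper passes to the dual pair `(X', Y)` with `X' = −(ℤ/pℤ ∖ (X+Y))`
  and quotes Lemma 13 for it.  We run the same dichotomy on `(S, N)` (`S` the missing points,
  `N` the reflected `Y`, so that `S + N` is a translate of `S − Y ⊆ ℤ/pℤ ∖ X`, i.e. of
  `−(X' + Y)`): when `|S + N| ≤ |S| + |N|` the inverse theorems of Vosper and Hamidoune–Rødseth (both in the tree)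
  replace the appeal to Lemma 13, and the supplement `eq_or_eq_neg_of_two_progressions` (a dense
  subset of a short `d`-progression lies in a short `e`-progression only for `e = ±d`; no
  wrap-around since `L ≤ 16 < p/2`) identifies the difference; when `|S + N| = |S| + |N| + 1`,
  Lemmas 11–13 apply to `(S, N)` verbatim and the rectified case is closed by the count
  `card_le_two_mul_card_inter` (`|S| ≤ 2 · |X ∩ T| ≤ 4` for the progression `T ⊇ ℤ/pℤ ∖ X`), an
  argument of ours standing in for the paper's last two sentences.  The prime `p > 32` enters as
  `p ≥ 37` (so `|X| ≥ 11` and `2(|Y| + 2) ≤ p` in the residual regime).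
* All statements are for a general step `d ≠ 0` (the paper normalises `d = 1` by an affine map,
  «there is no loss of generality in considering equivalent sets», p. 102).
-/

namespace Literature.Combinatorics.Additive

open Finset
open scoped Pointwise

namespace CompressionTransfer

/-! ## Two pigeonhole lemmas on progressions of integers -/

/-- A subset of `{0, …, N}` with more than `(N + 2)/2` elements contains two consecutive integers
(`J` and `J + 1` cannot be disjoint inside `{0, …, N + 1}`). [folklore] -/
private theorem exists_succ_mem_of_card {J : Finset ℕ} {N : ℕ} (hJ : J ⊆ range (N + 1))
    (hcard : N + 2 < 2 * #J) : ∃ j ∈ J, j + 1 ∈ J := by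
  classical
  by_contra h
  push Not at h
  have hdisj : Disjoint J (J.image (· + 1)) := by
    rw [disjoint_left]
    intro x hx hx'
    rw [mem_image] at hx'
    obtain ⟨j, hj, rfl⟩ := hx'
    exact h j hj hx
  have hsub : J ∪ J.image (· + 1) ⊆ range (N + 2) := by
    intro x hx
    rw [mem_union, mem_image] at hx
    rw [mem_range]
    rcases hx with hx | ⟨j, hj, rfl⟩
    · have := mem_range.1 (hJ hx); omega
    · have := mem_range.1 (hJ hj); omega
  have h1 := card_le_card hsub
  rw [card_union_of_disjoint hdisj, card_image_of_injective _ (add_left_injective 1),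
    card_range] at h1
  omega

/-- If `B ⊆ {b₀ + j d : 0 ≤ j ≤ N}` (`d > 0`) has more than `(N + 2)/2` elements then two elements
of `B` differ by exactly `d`; hence every common divisor `d'` of the differences of `B` divides `d`.
[folklore] -/
private theorem dvd_of_subset_apFinset {B : Finset ℤ} {b₀ d d' : ℤ} {N : ℕ}
    (hB : B ⊆ apFinset b₀ d (N + 1)) (hcard : N + 2 < 2 * #B)
    (hd' : ∀ x ∈ B, ∀ y ∈ B, d' ∣ x - y) : d' ∣ d := by
  classical
  set J : Finset ℕ := (range (N + 1)).filter fun j => b₀ + (j : ℤ) * d ∈ B with hJ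
  have hBsub : B ⊆ J.image fun j : ℕ => b₀ + (j : ℤ) * d := by
    intro x hx
    obtain ⟨j, hj, hjx⟩ := mem_apFinset.1 (hB hx)
    rw [nsmul_eq_mul] at hjx
    exact mem_image.2 ⟨j, mem_filter.2 ⟨mem_range.2 hj, by rw [hjx]; exact hx⟩, hjx⟩
  have hcardJ : #B ≤ #J := (card_le_card hBsub).trans card_image_le
  obtain ⟨j, hj, hj1⟩ := exists_succ_mem_of_card (J := J) (filter_subset _ _) (by omega)
  have hx := (mem_filter.1 hj).2
  have hy := (mem_filter.1 hj1).2
  have := hd' _ hy _ hx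
  have heq : b₀ + ((j + 1 : ℕ) : ℤ) * d - (b₀ + (j : ℤ) * d) = d := by push_cast; ring
  rwa [heq] at this

/-- Elements of a progression of integers differ by multiples of its difference. [folklore] -/
private theorem dvd_sub_of_mem_apFinset {b₀ d x y : ℤ} {n : ℕ} (hx : x ∈ apFinset b₀ d n)
    (hy : y ∈ apFinset b₀ d n) : d ∣ x - y := by
  obtain ⟨i, -, rfl⟩ := mem_apFinset.1 hx
  obtain ⟨j, -, rfl⟩ := mem_apFinset.1 hy
  rw [nsmul_eq_mul, nsmul_eq_mul]
  exact ⟨(i : ℤ) - j, by ring⟩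

/-! ## §3, Lemma 9: the `ℤ` counterpart of the main theorem -/

/-- Erasing the maximum of a set of at least two integers does not change its minimum. [folklore] -/
private theorem min'_erase_max' {B : Finset ℤ} (hB : B.Nonempty) (h2 : 2 ≤ #B)
    (hB' : (B.erase (B.max' hB)).Nonempty) : (B.erase (B.max' hB)).min' hB' = B.min' hB := by
  have hlt : B.min' hB < B.max' hB := B.min'_lt_max'_of_card (by omega)
  have hmem : B.min' hB ∈ B.erase (B.max' hB) := mem_erase.2 ⟨hlt.ne, min'_mem B hB⟩
  refine le_antisymm (min'_le _ _ hmem) ?_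
  exact le_min' _ _ _ fun y hy => min'_le B y (mem_of_mem_erase hy)

/-- **Lemma 9, core form (induction on `|B|`).**  For `A, B ⊂ ℤ` with `4 ≤ |A| ≤ |B|`, `5 ≤ |B|`
and `|A + B| ≤ |A| + |B| + 1`, there is ONE `d > 0` with `A ⊆ {min A + i d : i ≤ |A| + 1}` and
`B ⊆ {min B + j d : j ≤ |B| + 1}` (each set lies in a progression of difference `d` with at most two
terms missing).  Proof as printed, with Lev–Smeliansky's theorem in the packaged form
`lev_smeliansky_inverse` (Nathanson, Thm 4.8): if `diam B ≤ diam A` it gives both inclusions at once;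
if `diam A < diam B` it gives `B`'s inclusion and `A`'s when `|B| ≤ |A| + 1`, and otherwise one
removes `max B` and inducts — the two differences so obtained coincide because `B ∖ {max B}` has
`|B| − 1 ≥ 5` elements in both progressions (two of them are consecutive in each).  The printed
normalisation `gcd(A) = gcd(B) = 1` is replaced by carrying the common difference `d`.
[cite: HamidouneSerraZemor2006, Lemma 9] -/
theorem subset_apFinset_pair_int_min' :
    ∀ (n : ℕ) {A B : Finset ℤ} (hA : A.Nonempty) (hB : B.Nonempty), #B = n → 4 ≤ #A → #A ≤ #B →
      5 ≤ #B → #(A + B) ≤ #A + #B + 1 →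
      ∃ d : ℤ, 0 < d ∧ A ⊆ apFinset (A.min' hA) d (#A + 2) ∧ B ⊆ apFinset (B.min' hB) d (#B + 2) := by
  classical
  intro n
  induction n using Nat.strong_induction_on with
  | _ n ih =>
  intro A B hA hB hBn hA4 hAB hB5 hsum
  by_cases hdiam : B.max' hB - B.min' hB ≤ A.max' hA - A.min' hA
  · -- `diam B ≤ diam A`: Lev–Smeliansky for `(A, B)` gives progressions of `|A+B| − |B| + 1 ≤ |A| + 2` terms
    have hsmall : (#(A + B) : ℤ) ≤ #A + #B +
        min (#A : ℤ) (#B - (if B.max' hB - B.min' hB = A.max' hA - A.min' hA then 1 else 0)) - 3 := by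
      have h4 : (4 : ℤ) ≤ min (#A : ℤ) (#B -
          (if B.max' hB - B.min' hB = A.max' hA - A.min' hA then 1 else 0)) := by
        refine le_min (by exact_mod_cast hA4) ?_
        split_ifs <;> omega
      have : (#(A + B) : ℤ) ≤ #A + #B + 1 := by exact_mod_cast hsum
      linarith
    obtain ⟨d, hd, hAs, hBs⟩ := lev_smeliansky_inverse hA hB hdiam hsmall
    rw [Rectification.image_range_eq_apFinset] at hAs hBs
    refine ⟨d, hd, hAs.trans (Rectification.apFinset_subset_apFinset_of_le _ _ (by omega)),
      hBs.trans (Rectification.apFinset_subset_apFinset_of_le _ _ (by omega))⟩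
  · -- `diam A < diam B`: Lev–Smeliansky for `(B, A)`
    push Not at hdiam
    have hsmall : (#(B + A) : ℤ) ≤ #B + #A +
        min (#B : ℤ) (#A - (if A.max' hA - A.min' hA = B.max' hB - B.min' hB then 1 else 0)) - 3 := by
      rw [if_neg hdiam.ne, add_comm B A]
      have h4 : (4 : ℤ) ≤ min (#B : ℤ) (#A - 0) := le_min (by omega) (by omega)
      have : (#(A + B) : ℤ) ≤ #A + #B + 1 := by exact_mod_cast hsum
      linarith
    obtain ⟨d, hd, hBs, hAs⟩ := lev_smeliansky_inverse hB hA hdiam.le hsmall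
    rw [Rectification.image_range_eq_apFinset, add_comm B A] at hAs hBs
    have hBs' : B ⊆ apFinset (B.min' hB) d (#B + 2) :=
      hBs.trans (Rectification.apFinset_subset_apFinset_of_le _ _ (by omega))
    by_cases hBA : #B ≤ #A + 1
    · -- then `diam A < diam B ≤ (|B| + 1) d ≤ (|A| + 2) d` bounds the index of every `a ∈ A`
      refine ⟨d, hd, ?_, hBs'⟩
      intro x hx
      obtain ⟨i, -, hix⟩ := mem_apFinset.1 (hAs hx)
      obtain ⟨j, hj, hjb⟩ := mem_apFinset.1 (hBs' (max'_mem B hB))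
      rw [nsmul_eq_mul] at hix hjb
      have hxle : x ≤ A.max' hA := le_max' A x hx
      have h1 : (i : ℤ) * d < j * d := by linarith
      have h2 : (i : ℤ) < j := lt_of_mul_lt_mul_right h1 hd.le
      exact mem_apFinset.2 ⟨i, by exact_mod_cast (show (i : ℤ) < #A + 2 by omega),
        by rw [nsmul_eq_mul]; exact hix⟩
    · -- `|B| ≥ |A| + 2`: remove `max B` and induct
      push Not at hBA
      set b₁ := B.max' hB with hb₁
      set B' := B.erase b₁ with hB'def
      have hB'card : #B' = #B - 1 := card_erase_of_mem (max'_mem B hB)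
      have hB'ne : B'.Nonempty := card_pos.1 (by omega)
      have hminB' : B'.min' hB'ne = B.min' hB := min'_erase_max' hB (by omega) hB'ne
      -- `|A + B'| ≤ |A + B| − 1`
      have hsum' : #(A + B') ≤ #A + #B' + 1 := by
        have hsub : A + B' ⊆ (A + B).erase (A.max' hA + b₁) := by
          intro x hx
          obtain ⟨a, ha, b, hb, rfl⟩ := mem_add.1 hx
          have hbB : b ∈ B := mem_of_mem_erase hb
          have hbne : b ≠ b₁ := (mem_erase.1 hb).1
          have hblt : b < b₁ := lt_of_le_of_ne (le_max' B b hbB) hbne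
          have hale : a ≤ A.max' hA := le_max' A a ha
          exact mem_erase.2 ⟨by intro h; linarith, mem_add.2 ⟨a, ha, b, hbB, rfl⟩⟩
        have hmem : A.max' hA + b₁ ∈ A + B := mem_add.2 ⟨_, max'_mem A hA, _, max'_mem B hB, rfl⟩
        have := card_le_card hsub
        rw [card_erase_of_mem hmem] at this
        omega
      obtain ⟨d', hd', hAs', hBs''⟩ :=
        ih (#B - 1) (by omega) hA hB'ne hB'card hA4 (by omega) (by omega) hsum'
      rw [hminB', hB'card, show #B - 1 + 2 = #B + 1 by omega] at hBs''
      -- the two differences coincide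
      have hB'sub : B' ⊆ apFinset (B.min' hB) d (#B + 2) := (erase_subset _ _).trans hBs'
      have h1 : d' ∣ d :=
        dvd_of_subset_apFinset (N := #B + 1) hB'sub (by omega)
          fun x hx y hy => dvd_sub_of_mem_apFinset (hBs'' hx) (hBs'' hy)
      have h2 : d ∣ d' :=
        dvd_of_subset_apFinset (N := #B) hBs'' (by omega)
          fun x hx y hy => dvd_sub_of_mem_apFinset (hB'sub hx) (hB'sub hy)
      have hdd : d = d' := Int.dvd_antisymm hd.le hd'.le h2 h1
      subst hdd
      exact ⟨d, hd, hAs', hBs'⟩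

/-- **Lemma 9 (symmetric packaged form).**  "Let `A` and `B` be subsets of `ℤ` such that
`0 ∈ A ∩ B` and `|A + B| ≤ |A| + |B| + 1`, `|B| ≥ |A| ≥ 4`, `|B| ≥ 5`.  Then `A` and `B` have the
same greatest common divisor `r = gcd(A) = gcd(B)` and `ℓ_r(A) ≤ |A| + 2` and `ℓ_r(B) ≤ |B| + 2`."
Here: for `|A|, |B| ≥ 4`, `max(|A|, |B|) ≥ 5`, `|A + B| ≤ |A| + |B| + 1`, both sets lie in
arithmetic progressions with ONE common difference `d > 0` and `|A| + 2`, `|B| + 2` terms (the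
translation `0 ∈ A ∩ B` and the naming of `d` as the common gcd are dropped; cf. the one-above
analogue `Rectification.almostAP_pair_int`). [cite: HamidouneSerraZemor2006, Lemma 9] -/
theorem subset_apFinset_pair_int {A B : Finset ℤ} (hA4 : 4 ≤ #A) (hB4 : 4 ≤ #B)
    (h5 : 5 ≤ max #A #B) (h : #(A + B) ≤ #A + #B + 1) :
    ∃ d : ℤ, 0 < d ∧ ∃ a b : ℤ, A ⊆ apFinset a d (#A + 2) ∧ B ⊆ apFinset b d (#B + 2) := by
  have hA : A.Nonempty := card_pos.1 (by omega)
  have hB : B.Nonempty := card_pos.1 (by omega)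
  rcases le_total #A #B with hle | hle
  · obtain ⟨d, hd, hAs, hBs⟩ := subset_apFinset_pair_int_min' #B hA hB rfl hA4 hle
      (by rw [max_eq_right hle] at h5; exact h5) h
    exact ⟨d, hd, _, _, hAs, hBs⟩
  · obtain ⟨d, hd, hBs, hAs⟩ := subset_apFinset_pair_int_min' #A hB hA rfl hB4 hle
      (by rw [max_eq_left hle] at h5; exact h5) (by rw [add_comm B A]; omega)
    exact ⟨d, hd, _, _, hAs, hBs⟩

/-! ## Lemma 11's mechanism: sets inside `d`-runs of total length `≤ p + 1` add like integers -/

section Rectify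

variable {p : ℕ} [hp : Fact p.Prime]

/-- Casting the integer interval `[0, K)` into `ℤ/pℤ` is injective when `K ≤ p`. [folklore] -/
private theorem intCast_injOn_Ico {K : ℕ} (hK : K ≤ p) :
    Set.InjOn (fun i : ℤ => (i : ZMod p)) (Ico (0 : ℤ) K : Set ℤ) := by
  intro i hi j hj hij
  rw [coe_Ico, Set.mem_Ico] at hi hj
  have h : (p : ℤ) ∣ j - i := (ZMod.intCast_eq_intCast_iff_dvd_sub i j p).1 hij
  have h0 : j - i = 0 := by
    refine Int.eq_zero_of_dvd_of_natAbs_lt_natAbs h ?_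
    simp only [Int.natAbs_natCast]
    omega
  omega

/-- The integer lift of `U ⊆ {u, u + d, …, u + (M−1)d}`: the set of indices `i ∈ [0, M)` with
`u + i d ∈ U`. [cite: HamidouneSerraZemor2006, Lemma 11 (proof: «X + Y can really be considered
as a sum in ℤ»)] -/
noncomputable def lift (U : Finset (ZMod p)) (u d : ZMod p) (M : ℕ) : Finset ℤ :=
  (Ico (0 : ℤ) M).filter fun i => u + (i : ZMod p) * d ∈ U

/-- Unfolding `lift`. [cite: HamidouneSerraZemor2006, Lemma 11 (proof)] -/
theorem mem_lift {U : Finset (ZMod p)} {u d : ZMod p} {M : ℕ} {i : ℤ} :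
    i ∈ lift U u d M ↔ (0 ≤ i ∧ i < M) ∧ u + (i : ZMod p) * d ∈ U := by
  rw [lift, mem_filter, mem_Ico]

/-- Every element of `U ⊆ {u + i d : i < M}` comes from the lift. [cite: HamidouneSerraZemor2006,
Lemma 11 (proof)] -/
theorem exists_mem_lift {U : Finset (ZMod p)} {u d : ZMod p} {M : ℕ} (hU : U ⊆ apFinset u d M)
    {x : ZMod p} (hx : x ∈ U) : ∃ i ∈ lift U u d M, u + (i : ZMod p) * d = x := by
  obtain ⟨j, hj, hjx⟩ := mem_apFinset.1 (hU hx)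
  refine ⟨j, mem_lift.2 ⟨⟨by positivity, by exact_mod_cast hj⟩, ?_⟩, ?_⟩
  · rw [Int.cast_natCast, ← nsmul_eq_mul, hjx]; exact hx
  · rw [Int.cast_natCast, ← nsmul_eq_mul, hjx]

/-- The lift projects onto `U`. [cite: HamidouneSerraZemor2006, Lemma 11 (proof)] -/
theorem image_lift {U : Finset (ZMod p)} {u d : ZMod p} {M : ℕ} (hU : U ⊆ apFinset u d M) :
    (lift U u d M).image (fun i : ℤ => u + (i : ZMod p) * d) = U := by
  ext x
  rw [mem_image]
  constructor
  · rintro ⟨i, hi, rfl⟩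
    exact (mem_lift.1 hi).2
  · intro hx
    obtain ⟨i, hi, hix⟩ := exists_mem_lift hU hx
    exact ⟨i, hi, hix⟩

/-- The lift has the cardinality of `U` (for `d ≠ 0`, `M ≤ p`). [cite: HamidouneSerraZemor2006,
Lemma 11 (proof)] -/
theorem card_lift {U : Finset (ZMod p)} {u d : ZMod p} (hd : d ≠ 0) {M : ℕ} (hM : M ≤ p)
    (hU : U ⊆ apFinset u d M) : #(lift U u d M) = #U := by
  conv_rhs => rw [← image_lift hU]
  rw [card_image_of_injOn]
  intro i hi j hj hij
  have hi' := (mem_lift.1 hi).1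
  have hj' := (mem_lift.1 hj).1
  have h1 : ((i : ZMod p)) * d = (j : ZMod p) * d := add_left_cancel hij
  have h2 : (i : ZMod p) = (j : ZMod p) := mul_right_cancel₀ hd h1
  exact intCast_injOn_Ico hM (by rw [coe_Ico]; exact ⟨hi'.1, hi'.2⟩)
    (by rw [coe_Ico]; exact ⟨hj'.1, hj'.2⟩) h2

/-- The lifts add like the original sets: `|U' + V'| = |U + V|` when `M + L ≤ p + 1`.
[cite: HamidouneSerraZemor2006, Lemma 11 (proof)] -/
theorem card_lift_add_lift {U V : Finset (ZMod p)} {u v d : ZMod p} (hd : d ≠ 0) {M L : ℕ}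
    (hML : M + L ≤ p + 1) (hU : U ⊆ apFinset u d M) (hV : V ⊆ apFinset v d L) :
    #(lift U u d M + lift V v d L) = #(U + V) := by
  classical
  have himage : (lift U u d M + lift V v d L).image (fun i : ℤ => u + v + (i : ZMod p) * d)
      = U + V := by
    ext x
    rw [mem_image]
    constructor
    · rintro ⟨k, hk, rfl⟩
      obtain ⟨i, hi, j, hj, rfl⟩ := mem_add.1 hk
      refine mem_add.2 ⟨_, (mem_lift.1 hi).2, _, (mem_lift.1 hj).2, ?_⟩
      push_cast; ring
    · intro hx
      obtain ⟨a, ha, b, hb, rfl⟩ := mem_add.1 hx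
      obtain ⟨i, hi, rfl⟩ := exists_mem_lift hU ha
      obtain ⟨j, hj, rfl⟩ := exists_mem_lift hV hb
      exact ⟨i + j, mem_add.2 ⟨i, hi, j, hj, rfl⟩, by push_cast; ring⟩
  rw [← himage, card_image_of_injOn]
  intro i hi j hj hij
  have hmem : ∀ k ∈ (lift U u d M + lift V v d L : Finset ℤ), 0 ≤ k ∧ k < ((M + L - 1 : ℕ) : ℤ) := by
    intro k hk
    obtain ⟨a, ha, b, hb, rfl⟩ := mem_add.1 hk
    have ha' := (mem_lift.1 ha).1
    have hb' := (mem_lift.1 hb).1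
    constructor
    · omega
    · have h1 : 1 ≤ M + L := by omega
      rw [Nat.cast_sub h1]
      push_cast
      omega
  have h1 : ((i : ZMod p)) * d = (j : ZMod p) * d := add_left_cancel hij
  have h2 : (i : ZMod p) = (j : ZMod p) := mul_right_cancel₀ hd h1
  exact intCast_injOn_Ico (K := M + L - 1) (by omega) (by rw [coe_Ico]; exact hmem i hi)
    (by rw [coe_Ico]; exact hmem j hj) h2

/-- The integer interval `[0, L)` is the progression `apFinset 0 1 L` of `ℤ`. [folklore] -/
private theorem Ico_subset_apFinset_zero_one (L : ℕ) : Ico (0 : ℤ) L ⊆ apFinset 0 1 L := by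
  intro i hi
  rw [mem_Ico] at hi
  refine mem_apFinset.2 ⟨i.toNat, by omega, ?_⟩
  rw [nsmul_one, zero_add]
  exact_mod_cast Int.toNat_of_nonneg hi.1

/-- **Lemma 11 (the rectifiable case), as a transfer statement.**  If `U` lies in a `d`-progression
with `M` terms and `V` in one with `L` terms, `M + L ≤ p + 1` («in other words `X + Y` can really be
considered as a sum in `ℤ`»), `|U|, |V| ≥ 4`, `max(|U|, |V|) ≥ 5`, `L ≤ |V| + 2` and
`|U + V| ≤ |U| + |V| + 1`, then `U` lies in a `d`-progression with `|U| + 2` terms.  Proof: lift,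
apply Lemma 9 (`subset_apFinset_pair_int`), and note that the common difference of the two integer
progressions must be `1` because the lift of `V` has more than half of the `L` points of `[0, L)`.
[cite: HamidouneSerraZemor2006, Lemma 11] -/
theorem subset_apFinset_of_short_runs {U V : Finset (ZMod p)} {u v d : ZMod p} (hd : d ≠ 0)
    {M L : ℕ} (hU : U ⊆ apFinset u d M) (hV : V ⊆ apFinset v d L) (hML : M + L ≤ p + 1)
    (hU4 : 4 ≤ #U) (hV4 : 4 ≤ #V) (h5 : 5 ≤ max #U #V) (hLV : L ≤ #V + 2)
    (hUV : #(U + V) ≤ #U + #V + 1) : ∃ u' : ZMod p, U ⊆ apFinset u' d (#U + 2) := by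
  classical
  have hL1 : 1 ≤ L := by
    by_contra h
    have hL0 : L = 0 := by omega
    rw [hL0, apFinset_zero] at hV
    rw [subset_empty.1 hV, card_empty] at hV4
    omega
  have hM1 : 1 ≤ M := by
    by_contra h
    have hM0 : M = 0 := by omega
    rw [hM0, apFinset_zero] at hU
    rw [subset_empty.1 hU, card_empty] at hU4
    omega
  set U' := lift U u d M with hU'
  set V' := lift V v d L with hV'
  have hcU : #U' = #U := card_lift hd (by omega) hU
  have hcV : #V' = #V := card_lift hd (by omega) hV
  have hcUV : #(U' + V') = #(U + V) := card_lift_add_lift hd hML hU hV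
  obtain ⟨δ, hδ, a, b, hUs, hVs⟩ := subset_apFinset_pair_int (A := U') (B := V') (by omega)
    (by omega) (by rw [hcU, hcV]; exact h5) (by omega)
  -- `δ = 1`: the lift of `V` is a subset of `[0, L)` with more than `(L + 1)/2` elements
  have hV'sub : V' ⊆ apFinset (0 : ℤ) 1 ((L - 1) + 1) := by
    rw [Nat.sub_add_cancel hL1]
    exact (filter_subset _ _).trans (Ico_subset_apFinset_zero_one L)
  have hδ1 : δ ∣ 1 := dvd_of_subset_apFinset (N := L - 1) hV'sub (by omega)
    fun x hx y hy => dvd_sub_of_mem_apFinset (hVs hx) (hVs hy)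
  have hδone : δ = 1 := by
    have := Int.le_of_dvd one_pos hδ1
    omega
  subst hδone
  refine ⟨u + (a : ZMod p) * d, fun x hx => ?_⟩
  obtain ⟨i, hi, rfl⟩ := exists_mem_lift hU hx
  obtain ⟨k, hk, hki⟩ := mem_apFinset.1 (hUs hi)
  rw [hcU] at hk
  refine mem_apFinset.2 ⟨k, hk, ?_⟩
  rw [← hki, nsmul_one]
  push_cast
  rw [nsmul_eq_mul]
  ring

end Rectify

/-! ## The accounting device for Lemmas 12–13: missing points, their predecessors and windows

For a finite `W ⊆ ℤ/pℤ` (the complement of `X + Y` in the application) and a step `d`, every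
`z ∈ W` has a PREDECESSOR `z − t d ∈ W`, `t = t(z) ≥ 1` least; the "windows"
`{z, z − d, …, z − (t − 1) d}` of distinct points of `W` are pairwise disjoint, and `z ↦ z − t(z) d`
permutes `W`.  This replaces the paper's bookkeeping by connected components `C_i` of the complement
of `X` (display (4)): we count complement points window by window instead of gap by gap. -/

section Windows

variable {p : ℕ} [hp : Fact p.Prime]

/-- In `ℤ/pℤ`, `p • d = 0`. [folklore] -/
private theorem p_nsmul (d : ZMod p) : p • d = 0 := by
  rw [nsmul_eq_mul, ZMod.natCast_self, zero_mul]

/-- `k ↦ z − k • d` is injective on `k < p` (`d ≠ 0`). [folklore] -/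
private theorem sub_nsmul_inj {d : ZMod p} (hd : d ≠ 0) (z : ZMod p) {i j : ℕ} (hi : i < p)
    (hj : j < p) (h : z - i • d = z - j • d) : i = j := by
  have h1 : i • d = j • d := by
    have := congrArg (fun x => z - x) h
    simpa using this
  exact HamidouneRodseth.nat_eq_of_nsmul_eq hd hi hj h1

open Classical in
/-- The back-distance `t(z)`: the least `t ≥ 1` with `z − t d ∈ W` (and `0` if there is none, which
does not happen for `z ∈ W`). [cite: HamidouneSerraZemor2006, §3 (proof of Theorem 10, display (4):
our replacement for the gap decomposition)] -/
noncomputable def backDist (W : Finset (ZMod p)) (d z : ZMod p) : ℕ :=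
  if h : ∃ k : ℕ, 0 < k ∧ z - k • d ∈ W then Nat.find h else 0

/-- For `z ∈ W` the defining existential of `backDist` holds (`k = p`). [folklore] -/
private theorem backDist_aux {W : Finset (ZMod p)} {z : ZMod p} (hz : z ∈ W) (d : ZMod p) :
    ∃ k : ℕ, 0 < k ∧ z - k • d ∈ W :=
  ⟨p, hp.out.pos, by rw [p_nsmul, sub_zero]; exact hz⟩

/-- Basic properties of `t(z)` for `z ∈ W`: `1 ≤ t ≤ p`, `z − t d ∈ W`, and no point of `W` strictly
between. [cite: HamidouneSerraZemor2006, §3 (proof of Theorem 10)] -/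
theorem backDist_spec {W : Finset (ZMod p)} {d z : ZMod p} (hz : z ∈ W) :
    0 < backDist W d z ∧ backDist W d z ≤ p ∧ z - backDist W d z • d ∈ W ∧
      ∀ k : ℕ, 0 < k → k < backDist W d z → z - k • d ∉ W := by
  have h := backDist_aux hz d
  have hdef : backDist W d z = Nat.find h := by rw [backDist, dif_pos h]
  rw [hdef]
  refine ⟨(Nat.find_spec h).1, ?_, (Nat.find_spec h).2, fun k hk hlt hkW => ?_⟩
  · exact Nat.find_min' h ⟨hp.out.pos, by rw [p_nsmul, sub_zero]; exact hz⟩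
  · exact Nat.find_min h hlt ⟨hk, hkW⟩

/-- The predecessor `z ↦ z − t(z) d` maps `W` to `W`. [cite: HamidouneSerraZemor2006, §3 (proof of
Theorem 10)] -/
theorem pred_mem {W : Finset (ZMod p)} {d z : ZMod p} (hz : z ∈ W) :
    z - backDist W d z • d ∈ W :=
  (backDist_spec hz).2.2.1

/-- Window disjointness: if `z₁ − k₁ d = z₂ − k₂ d` with `k_i < t(z_i)`, then `z₁ = z₂` (and
`k₁ = k₂`). [cite: HamidouneSerraZemor2006, §3 (proof of Theorem 10)] -/
theorem eq_of_window_meet {W : Finset (ZMod p)} {d : ZMod p} {z₁ z₂ : ZMod p}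
    (hz₁ : z₁ ∈ W) (hz₂ : z₂ ∈ W) {k₁ k₂ : ℕ} (hk₁ : k₁ < backDist W d z₁)
    (hk₂ : k₂ < backDist W d z₂) (h : z₁ - k₁ • d = z₂ - k₂ • d) : z₁ = z₂ ∧ k₁ = k₂ := by
  obtain ⟨-, ht₁, -, hmin₁⟩ := backDist_spec (d := d) hz₁
  obtain ⟨-, ht₂, -, hmin₂⟩ := backDist_spec (d := d) hz₂
  rcases lt_trichotomy k₁ k₂ with hlt | heq | hgt
  · -- `z₂ = z₁ + (k₂ − k₁) d`, so `z₂ − (k₂−k₁) d = z₁ ∈ W` with `0 < k₂ − k₁ < t(z₂)`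
    exfalso
    refine hmin₂ (k₂ - k₁) (by omega) (by omega) ?_
    have : z₂ - (k₂ - k₁) • d = z₁ := by
      have e : k₂ • d = (k₂ - k₁) • d + k₁ • d := by rw [← add_nsmul]; congr 1; omega
      rw [e] at h
      linear_combination -h
    rw [this]; exact hz₁
  · subst heq
    exact ⟨by simpa using h, rfl⟩
  · exfalso
    refine hmin₁ (k₁ - k₂) (by omega) (by omega) ?_
    have : z₁ - (k₁ - k₂) • d = z₂ := by
      have e : k₁ • d = (k₁ - k₂) • d + k₂ • d := by rw [← add_nsmul]; congr 1; omega
      rw [e] at h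
      linear_combination h
    rw [this]; exact hz₂

/-- The predecessor map is injective on `W`. [cite: HamidouneSerraZemor2006, §3 (proof of Theorem 10)] -/
theorem pred_injOn {W : Finset (ZMod p)} {d : ZMod p} :
    Set.InjOn (fun z => z - backDist W d z • d) (W : Set (ZMod p)) := by
  intro z₁ hz₁ z₂ hz₂ h
  rw [mem_coe] at hz₁ hz₂
  obtain ⟨ht₁, hp₁, hw₁, hmin₁⟩ := backDist_spec (d := d) hz₁
  obtain ⟨ht₂, hp₂, hw₂, hmin₂⟩ := backDist_spec (d := d) hz₂
  simp only at h
  set t₁ := backDist W d z₁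
  set t₂ := backDist W d z₂
  rcases lt_trichotomy t₁ t₂ with hlt | heq | hgt
  · exfalso
    refine hmin₂ (t₂ - t₁) (by omega) (by omega) ?_
    have : z₂ - (t₂ - t₁) • d = z₁ := by
      have e : t₂ • d = (t₂ - t₁) • d + t₁ • d := by rw [← add_nsmul]; congr 1; omega
      rw [e] at h
      linear_combination -h
    rw [this]; exact hz₁
  · have e : t₁ • d = t₂ • d := by rw [heq]
    rw [e] at h
    simpa using h
  · exfalso
    refine hmin₁ (t₁ - t₂) (by omega) (by omega) ?_
    have : z₁ - (t₁ - t₂) • d = z₂ := by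
      have e : t₁ • d = (t₁ - t₂) • d + t₂ • d := by rw [← add_nsmul]; congr 1; omega
      rw [e] at h
      linear_combination h
    rw [this]; exact hz₂

/-- The predecessor map permutes `W`, so sums over `W` are invariant under it (the telescoping behind
our discharging argument). [cite: HamidouneSerraZemor2006, §3 (proof of Theorem 10)] -/
theorem sum_pred_eq {W : Finset (ZMod p)} {d : ZMod p} (f : ZMod p → ℤ) :
    ∑ z ∈ W, f (z - backDist W d z • d) = ∑ z ∈ W, f z := by
  classical
  have himage : W.image (fun z => z - backDist W d z • d) = W := by
    apply eq_of_subset_of_card_le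
    · intro w hw
      rw [mem_image] at hw
      obtain ⟨z, hz, rfl⟩ := hw
      exact pred_mem hz
    · rw [card_image_of_injOn pred_injOn]
  conv_rhs => rw [← himage]
  rw [sum_image pred_injOn]

/-- The windows of distinct points of `W` are disjoint: for index sets `I z ⊆ [0, t(z))` the images
`{z − k d : k ∈ I z}` form a pairwise disjoint family, so their sizes add up inside any set containing
them. [cite: HamidouneSerraZemor2006, §3 (proof of Theorem 10)] -/
theorem sum_card_windows_le {W : Finset (ZMod p)} {d : ZMod p} (hd : d ≠ 0) (I : ZMod p → Finset ℕ)
    (hI : ∀ z ∈ W, ∀ k ∈ I z, k < backDist W d z) (A : Finset (ZMod p))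
    (hA : ∀ z ∈ W, ∀ k ∈ I z, z - k • d ∈ A) :
    ∑ z ∈ W, #(I z) ≤ #A := by
  classical
  have hinj : ∀ z ∈ W, Set.InjOn (fun k : ℕ => z - k • d) (I z : Set ℕ) := by
    intro z hz i hi j hj hij
    have htp := (backDist_spec (d := d) hz).2.1
    exact sub_nsmul_inj hd z (lt_of_lt_of_le (hI z hz i hi) htp)
      (lt_of_lt_of_le (hI z hz j hj) htp) hij
  have hdisj : (W : Set (ZMod p)).PairwiseDisjoint fun z => (I z).image fun k : ℕ => z - k • d := by
    intro z₁ hz₁ z₂ hz₂ hne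
    rw [Function.onFun, disjoint_left]
    intro x hx₁ hx₂
    rw [mem_image] at hx₁ hx₂
    obtain ⟨k₁, hk₁, rfl⟩ := hx₁
    obtain ⟨k₂, hk₂, h⟩ := hx₂
    exact hne (eq_of_window_meet hz₁ hz₂ (hI _ hz₁ _ hk₁) (hI _ hz₂ _ hk₂) h.symm).1
  calc ∑ z ∈ W, #(I z) = ∑ z ∈ W, #((I z).image fun k : ℕ => z - k • d) := by
        refine sum_congr rfl fun z hz => ?_
        rw [card_image_of_injOn (hinj z hz)]
    _ = #(W.biUnion fun z => (I z).image fun k : ℕ => z - k • d) := (card_biUnion hdisj).symm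
    _ ≤ #A := by
        refine card_le_card fun x hx => ?_
        rw [mem_biUnion] at hx
        obtain ⟨z, hz, hx⟩ := hx
        rw [mem_image] at hx
        obtain ⟨k, hk, rfl⟩ := hx
        exact hA z hz k hk

end Windows

/-! ## Lemmas 12–13 recast: no missing point when every `(L−1)`-run meets `X`

Standing data of this part (the paper's §3 after Lemma 11, normalised): `V ⊆ {0, d, …, (L−1)d}`
with `0 ∈ V` and `(L−1)d ∈ V` (so `L = ℓ_d(V)`), `L ≤ |V| + 2`; `U` arbitrary; the MISSING POINTS
are `W = ℤ/pℤ ∖ (U + V)`; and the negation of Lemma 11's hypothesis: every `d`-progression with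
`L − 1` terms meets `U` («`|C_j| < ℓ_1(Y) − 1`»).  The HOLES of `V` are the indices `0 < k < L` with
`k d ∉ V` (at most two of them). -/

section Holes

variable {p : ℕ} [hp : Fact p.Prime]

/-- A missing point is not in `U` (as `0 ∈ V`). [cite: HamidouneSerraZemor2006, §3 (display (4):
`X ⊆ X + Y`)] -/
theorem not_mem_of_missing {U V : Finset (ZMod p)} (h0 : (0 : ZMod p) ∈ V) {z : ZMod p}
    (hz : z ∉ U + V) : z ∉ U := fun hzU => hz (by simpa using add_mem_add hzU h0)

/-- A missing point `z` has `z − k d ∉ U` whenever `k d ∈ V`. [cite: HamidouneSerraZemor2006, §3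
(proof of Lemma 13: «`|(X_i + Y) ∩ C_i| ≥ |C_i| − 2`»)] -/
theorem sub_not_mem_of_missing {U V : Finset (ZMod p)} {d : ZMod p} {z : ZMod p} (hz : z ∉ U + V)
    {k : ℕ} (hk : k • d ∈ V) : z - k • d ∉ U := by
  intro h
  exact hz (by simpa using add_mem_add h hk)

/-- If every `(L−1)`-term `d`-progression meets `U`, a missing point `z` has a point of `U` at
`z − k d` for some HOLE index `0 < k < L`, `k d ∉ V`. [cite: HamidouneSerraZemor2006, §3 (proof of
Lemma 13, first sentence)] -/
theorem exists_hole_of_missing {U V : Finset (ZMod p)} {d : ZMod p} {L : ℕ}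
    (hB : ∀ c : ZMod p, ∃ x ∈ U, x ∈ apFinset c d (L - 1)) {z : ZMod p} (hz : z ∉ U + V) :
    ∃ k : ℕ, 0 < k ∧ k < L ∧ k • d ∉ V ∧ z - k • d ∈ U := by
  obtain ⟨x, hxU, hx⟩ := hB (z - (L - 1) • d)
  obtain ⟨i, hi, hix⟩ := mem_apFinset.1 hx
  have e : (L - 1) • d = (L - 1 - i) • d + i • d := by rw [← add_nsmul]; congr 1; omega
  have hxeq : z - (L - 1 - i) • d = x := by rw [← hix, e]; abel
  refine ⟨L - 1 - i, by omega, by omega, fun hV => ?_, by rw [hxeq]; exact hxU⟩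
  exact sub_not_mem_of_missing hz hV (by rw [hxeq]; exact hxU)

/-- `z − t d − k d = z − (t + k) d`. [folklore] -/
private theorem sub_nsmul_sub_nsmul (z d : ZMod p) (t k : ℕ) :
    z - t • d - k • d = z - (t + k) • d := by
  rw [add_nsmul]; abel

/-- The number of missing points: `p = |U + V| + |ℤ/pℤ ∖ (U + V)|`. [folklore] -/
private theorem card_add_card_missing (U V : Finset (ZMod p)) :
    #(U + V) + #(univ \ (U + V)) = p := by
  rw [card_sdiff_of_subset (subset_univ _), card_univ, ZMod.card,
    Nat.add_sub_cancel' ((card_le_univ _).trans_eq (ZMod.card p))]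

/-- `|ℤ/pℤ ∖ U| = p − |U|`. [folklore] -/
private theorem card_compl_eq (U : Finset (ZMod p)) : #(univ \ U) = p - #U := by
  rw [card_sdiff_of_subset (subset_univ _), card_univ, ZMod.card]

/-- **Lemma 12, second half (one hole), quantitative form.**  With the standing data, if `V` has
exactly ONE hole `η` (so `|V| = L − 1`) and every `(L−1)`-run meets `U`, then every missing point `z`
has `z − η d ∈ U`, its predecessor is at back-distance `t(z) ≥ max(η + 1, L − η)`, and its window
carries `min(t(z), L) − 1` complement points of `U`; summing, `D · max(η, L−1−η) ≤ D + L` for the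
number `D` of missing points — impossible when `D ≥ 11`, or when `L ≥ 17` and `D ≥ 5`.  (The paper's
form: «`|(X+Y) ∩ C_i| = |C_i|` or `|C_i| − 1 ≥ |Y_1| − 1` and `c_i − 2 ∉ X`», display (5), summed
over the components, ending in `p = 15`.) [cite: HamidouneSerraZemor2006, Lemma 12] -/
theorem false_of_one_hole {U V : Finset (ZMod p)} {d : ZMod p} (hd : d ≠ 0) {L η : ℕ}
    (h0 : (0 : ZMod p) ∈ V) (hlast : (L - 1) • d ∈ V) (hV4 : 4 ≤ #V) (hVL : #V + 1 = L)
    (hη : η < L) (hηV : η • d ∉ V) (huniq : ∀ k : ℕ, k < L → k • d ∉ V → k = η)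
    (hB : ∀ c : ZMod p, ∃ x ∈ U, x ∈ apFinset c d (L - 1))
    (hUV : #(U + V) ≤ #U + #V + 1)
    (hD : 11 ≤ #(univ \ (U + V)) ∨ (17 ≤ L ∧ 5 ≤ #(univ \ (U + V)))) : False := by
  classical
  set W := univ \ (U + V) with hW
  set D := #W with hDdef
  have hmemW : ∀ {z}, z ∈ W ↔ z ∉ U + V := fun {z} => by simp [hW]
  -- `η` is an interior index
  have hη0 : η ≠ 0 := by rintro rfl; exact hηV (by simpa using h0)
  have hηL : η ≠ L - 1 := by rintro rfl; exact hηV hlast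
  -- every missing point has `z − η d ∈ U`
  have hP : ∀ z ∈ W, z - η • d ∈ U := by
    intro z hz
    obtain ⟨k, hk0, hkL, hkV, hkU⟩ := exists_hole_of_missing hB (hmemW.1 hz)
    rw [huniq k hkL hkV] at hkU
    exact hkU
  -- back-distance bounds
  have hT : ∀ z ∈ W, η < backDist W d z ∧ L ≤ backDist W d z + η := by
    intro z hz
    obtain ⟨ht0, -, hw, -⟩ := backDist_spec (d := d) hz
    set t := backDist W d z with htdef
    have hwUV : z - t • d ∉ U + V := hmemW.1 hw
    constructor
    · by_contra hle
      push Not at hle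
      rcases hle.lt_or_eq with hlt | heq
      · -- `w − (η − t) d = z − η d ∈ U` forces `η − t` to be the hole
        have hmem : z - t • d - (η - t) • d ∈ U := by
          rw [sub_nsmul_sub_nsmul, Nat.add_sub_cancel' hlt.le]; exact hP z hz
        have hhole : (η - t) • d ∉ V := fun hV => sub_not_mem_of_missing hwUV hV hmem
        have := huniq (η - t) (by omega) hhole
        omega
      · exact not_mem_of_missing h0 hwUV (by rw [heq]; exact hP z hz)
    · by_contra hlt
      push Not at hlt
      have hmem : z - (t + η) • d ∈ U := by
        rw [← sub_nsmul_sub_nsmul]; exact hP _ hw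
      have hhole : (t + η) • d ∉ V := fun hV => sub_not_mem_of_missing (hmemW.1 hz) hV hmem
      have := huniq (t + η) (by omega) hhole
      omega
  -- windows: indices `k < min(t, L)`, `k ≠ η`, all give complement points of `U`
  set M := max η (L - 1 - η) with hM
  have hsum := sum_card_windows_le (W := W) hd (fun z => (range (min (backDist W d z) L)).erase η)
    (fun z hz k hk => by
      have := mem_range.1 (mem_of_mem_erase hk)
      exact lt_of_lt_of_le this (min_le_left _ _))
    (univ \ U) (fun z hz k hk => by
      rw [mem_sdiff]
      refine ⟨mem_univ _, ?_⟩
      have hkη : k ≠ η := (mem_erase.1 hk).1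
      have hkL : k < L := lt_of_lt_of_le (mem_range.1 (mem_of_mem_erase hk)) (min_le_right _ _)
      rcases Nat.eq_zero_or_pos k with rfl | hk0
      · simpa using not_mem_of_missing h0 (hmemW.1 hz)
      · have hkV : k • d ∈ V := by
          by_contra hkV
          exact hkη (huniq k hkL hkV)
        exact sub_not_mem_of_missing (hmemW.1 hz) hkV)
  have hcard : ∀ z ∈ W, M ≤ #((range (min (backDist W d z) L)).erase η) := by
    intro z hz
    obtain ⟨h1, h2⟩ := hT z hz
    rw [card_erase_of_mem (mem_range.2 (lt_min h1 hη)), card_range]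
    have hm1 : η + 1 ≤ min (backDist W d z) L := le_min h1 hη
    have hm2 : L - η ≤ min (backDist W d z) L := le_min (by omega) (by omega)
    rw [hM]
    exact max_le (by omega) (by omega)
  have hlow : D * M ≤ ∑ z ∈ W, #((range (min (backDist W d z) L)).erase η) := by
    rw [hDdef, ← smul_eq_mul, ← sum_const]
    exact sum_le_sum hcard
  have hhigh : #(univ \ U) ≤ D + L := by
    rw [card_compl_eq]
    have : #(U + V) + D = p := by rw [hDdef, hW]; exact card_add_card_missing U V
    omega
  have key : D * M ≤ D + L := hlow.trans (hsum.trans hhigh)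
  -- arithmetic
  have hM2 : L - 1 ≤ 2 * M := by
    have := le_max_left η (L - 1 - η)
    have := le_max_right η (L - 1 - η)
    omega
  have hM1 : 2 ≤ M := by
    have := le_max_left η (L - 1 - η)
    have := le_max_right η (L - 1 - η)
    omega
  have key' : D * (M - 1) ≤ L := by
    rw [Nat.mul_sub_one]
    omega
  rcases hD with h11 | ⟨h17, h5⟩
  · have := Nat.mul_le_mul_right (M - 1) h11
    omega
  · have := Nat.mul_le_mul_right (M - 1) h5
    omega

set_option maxHeartbeats 1600000 in
/-- The discharging inequality of `false_of_two_holes`, isolated as pure arithmetic: for a missing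
point `z` (membership bits `P₁, P₂`), its predecessor `w` (bits `Q₁, Q₂`) at back-distance `t`,
`m = min(t, L)` and `n` complement points of `U` counted in the window, the constraints listed in
`false_of_two_holes` imply `C ≤ 2(n − 1) + Φ(w) − Φ(z)`. [cite: HamidouneSerraZemor2006, Lemma 13
(proof, display (6))] -/
private theorem step_ineq {L η₁ η₂ a b g μ ρ ι t m n : ℕ} {C Φ2 Φ12 Δ : ℤ}
    {P1 P2 Q1 Q2 : Prop} [Decidable P1] [Decidable P2] [Decidable Q1] [Decidable Q2]
    (ha : a = η₁ + 1) (hb : b = L - η₂) (hg : g = η₂ - η₁) (hη : η₁ < η₂) (hη₂L : η₂ + 2 ≤ L)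
    (hη1 : 1 ≤ η₁) (hμf : a ≤ μ ∧ b ≤ μ ∧ (μ = a ∨ μ = b))
    (hρf : a + g ≤ ρ ∧ b ≤ ρ ∧ (ρ = a + g ∨ ρ = b))
    (hιf : (g = μ ∧ ι = 1) ∨ (g ≠ μ ∧ ι = 0))
    (hΔf : (a ≤ g ∧ Δ = 2 * (ι : ℤ) - 2) ∨ (g < a ∧ Δ = 2 * (ρ : ℤ) - μ - g - 3))
    (hC : C = (g : ℤ) + μ - 3 - ι) (hΦ2 : Φ2 = (g : ℤ) - μ + 1 - ι) (hΦ12 : Φ12 = Φ2 + Δ)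
    (hm : m ≤ t ∧ m ≤ L ∧ (m = t ∨ m = L))
    (hPz : P1 ∨ P2) (hPw : Q1 ∨ Q2)
    (h1 : P1 → η₁ < t) (h2 : P2 → η₂ < t ∨ (t = g ∧ Q1)) (h3 : Q1 → L ≤ t + η₁ ∨ (t = g ∧ P2))
    (h4 : Q2 → L ≤ t + η₂) (h5 : t = g → (Q1 ↔ P2))
    (hn2 : m ≤ n + 2) (hn1a : ¬ P1 → m ≤ n + 1) (hn1b : ¬ (P2 ∧ η₂ < t) → m ≤ n + 1)
    (hn0 : ¬ P1 → ¬ (P2 ∧ η₂ < t) → m ≤ n) :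
    C ≤ 2 * ((n : ℤ) - 1) + (if Q1 then (if Q2 then Φ12 else 0) else Φ2)
      - (if P1 then (if P2 then Φ12 else 0) else Φ2) := by
  by_cases hp1 : P1 <;> by_cases hp2 : P2 <;> by_cases hq1 : Q1 <;> by_cases hq2 : Q2 <;>
    by_cases ht2 : η₂ < t <;>
    simp only [hp1, hp2, hq1, hq2, ht2, if_true, if_false, and_true,
      and_false, not_true_eq_false, not_false_eq_true, true_implies, false_implies, imp_false,
      true_or, or_true, false_or, or_false, iff_true, iff_false]
      at h1 h2 h3 h4 h5 hPz hPw hn1a hn1b hn0 ⊢ <;>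
    omega

set_option maxHeartbeats 800000 in
/-- **Lemma 13 (two holes), quantitative form, by discharging.**  With the standing data, if `V`
has exactly TWO holes `η₁ < η₂` (so `|V| = L − 2`) and every `(L−1)`-run meets `U`, write, for a
missing point `z` with predecessor `w = z − t d`: `P₁(z) : z − η₁ d ∈ U`, `P₂(z) : z − η₂ d ∈ U`.
Then `P₁(z) ∨ P₂(z)`; `P₁(z) ⇒ t > η₁`; `P₂(z) ⇒ t > η₂` or (`t = η₂ − η₁` and `P₁(w)`);
`P₁(w) ⇒ t ≥ L − η₁` or (`t = η₂ − η₁` and `P₂(z)`); `P₂(w) ⇒ t ≥ L − η₂`; and the window of `z`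
carries at least `min(t, L) − [P₁ z] − [P₂ z ∧ η₂ < t]` complement points of `U`.  A potential
`Φ(z) ∈ ℤ` depending only on the type `(P₁ z, P₂ z)` makes
`2(ν(z) − 1) + Φ(w) − Φ(z) ≥ g + μ − 3 − [g = μ]` for every `z` (`g = η₂ − η₁`,
`μ = max(η₁ + 1, L − η₂)`); summing over the missing points (the predecessor map is a bijection)
gives `(g + μ − 3 − [g = μ]) · D ≤ 2(L − 1)`, impossible for `D ≥ 11` or for `L ≥ 17`, `D ≥ 5`.
This replaces the printed per-component table (6) and its two counts (`|Y| ≥ 10`; `|Y| ≤ 9` and at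
least `12` missing points) — same mechanism (short `X`-runs before deficient gaps), organised per
missing point; the thresholds `(10, 12)` of the paper become `(L ≥ 17, D ≥ 11)` here.
[cite: HamidouneSerraZemor2006, Lemma 13] -/
theorem false_of_two_holes {U V : Finset (ZMod p)} {d : ZMod p} (hd : d ≠ 0) {L η₁ η₂ : ℕ}
    (h0 : (0 : ZMod p) ∈ V) (hlast : (L - 1) • d ∈ V) (hV4 : 4 ≤ #V) (hVL : #V + 2 = L)
    (hη : η₁ < η₂) (hη₂L : η₂ < L) (hη₁V : η₁ • d ∉ V) (hη₂V : η₂ • d ∉ V)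
    (huniq : ∀ k : ℕ, k < L → k • d ∉ V → k = η₁ ∨ k = η₂)
    (hB : ∀ c : ZMod p, ∃ x ∈ U, x ∈ apFinset c d (L - 1))
    (hUV : #(U + V) ≤ #U + #V + 1)
    (hD : 11 ≤ #(univ \ (U + V)) ∨ (17 ≤ L ∧ 5 ≤ #(univ \ (U + V)))) : False := by
  classical
  set W := univ \ (U + V) with hW
  set D := #W with hDdef
  have hmemW : ∀ {z}, z ∈ W ↔ z ∉ U + V := fun {z} => by simp [hW]
  -- the holes are interior
  have hη0 : η₁ ≠ 0 := by rintro rfl; exact hη₁V (by simpa using h0)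
  have hη₂L' : η₂ ≠ L - 1 := by rintro rfl; exact hη₂V hlast
  -- hole indices of a missing point
  have hHole : ∀ z ∈ W, ∀ k : ℕ, k < L → z - k • d ∈ U → k = η₁ ∨ k = η₂ := by
    intro z hz k hkL hkU
    refine huniq k hkL fun hkV => sub_not_mem_of_missing (hmemW.1 hz) hkV hkU
  have hP : ∀ z ∈ W, z - η₁ • d ∈ U ∨ z - η₂ • d ∈ U := by
    intro z hz
    obtain ⟨k, hk0, hkL, hkV, hkU⟩ := exists_hole_of_missing hB (hmemW.1 hz)
    rcases huniq k hkL hkV with rfl | rfl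
    · exact Or.inl hkU
    · exact Or.inr hkU
  -- the parameters of the discharging
  set a : ℕ := η₁ + 1 with ha
  set b : ℕ := L - η₂ with hb
  set g : ℕ := η₂ - η₁ with hg
  set μ : ℕ := max a b with hμ
  set ρ : ℕ := max (a + g) b with hρ
  set ι : ℕ := if g = μ then 1 else 0 with hι
  set C : ℤ := (g : ℤ) + μ - 3 - ι with hC
  set Φ2 : ℤ := (g : ℤ) - μ + 1 - ι with hΦ2
  set Δ : ℤ := if a ≤ g then 2 * (ι : ℤ) - 2 else 2 * (ρ : ℤ) - μ - g - 3 with hΔ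
  set Φ12 : ℤ := Φ2 + Δ with hΦ12
  -- the potential and the window count
  set Φ : ZMod p → ℤ := fun x =>
    if x - η₁ • d ∈ U then (if x - η₂ • d ∈ U then Φ12 else 0) else Φ2 with hΦ
  set ν : ZMod p → ℕ := fun z =>
    #((range (min (backDist W d z) L)).filter fun k => z - k • d ∉ U) with hν
  clear_value Φ Φ12 Δ Φ2 C ι ρ μ g b a D W
  -- the discharging inequality, point by point
  have main : ∀ z ∈ W, C ≤ 2 * ((ν z : ℤ) - 1) + Φ (z - backDist W d z • d) - Φ z := by
    intro z hz
    obtain ⟨ht0, htp, hw, hmin⟩ := backDist_spec (d := d) hz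
    set t := backDist W d z with htdef
    have hzUV : z ∉ U + V := hmemW.1 hz
    have hwUV : z - t • d ∉ U + V := hmemW.1 hw
    have hwU : z - t • d ∉ U := not_mem_of_missing h0 hwUV
    -- the count: `U`-points in the window sit at the hole indices
    set F := (range (min t L)).filter fun k => z - k • d ∈ U with hF
    have hcnt : #F + ν z = min t L := by
      have h := card_filter_add_card_filter_not (s := range (min t L)) (fun k => z - k • d ∈ U)
      rw [card_range] at h
      exact h
    have hFsub : ∀ k ∈ F, (k = η₁ ∧ z - η₁ • d ∈ U) ∨ (k = η₂ ∧ z - η₂ • d ∈ U ∧ η₂ < t) := by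
      intro k hk
      rw [hF, mem_filter, mem_range] at hk
      obtain ⟨hklt, hkU⟩ := hk
      have hkL : k < L := lt_of_lt_of_le hklt (min_le_right _ _)
      have hkt : k < t := lt_of_lt_of_le hklt (min_le_left _ _)
      rcases hHole z hz k hkL hkU with rfl | rfl
      · exact Or.inl ⟨rfl, hkU⟩
      · exact Or.inr ⟨rfl, hkU, hkt⟩
    have hF2 : #F ≤ 2 := by
      refine (card_le_card (fun k hk => ?_ : F ⊆ {η₁, η₂})).trans (card_insert_le _ _ |>.trans
        (by rw [card_singleton]))
      rcases hFsub k hk with ⟨rfl, -⟩ | ⟨rfl, -⟩ <;> simp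
    have hF1a : z - η₁ • d ∉ U → #F ≤ 1 := by
      intro hn
      refine (card_le_card (fun k hk => ?_ : F ⊆ {η₂})).trans (by rw [card_singleton])
      rcases hFsub k hk with ⟨rfl, h⟩ | ⟨rfl, -⟩
      · exact absurd h hn
      · simp
    have hF1b : ¬ (z - η₂ • d ∈ U ∧ η₂ < t) → #F ≤ 1 := by
      intro hn
      refine (card_le_card (fun k hk => ?_ : F ⊆ {η₁})).trans (by rw [card_singleton])
      rcases hFsub k hk with ⟨rfl, -⟩ | ⟨rfl, h1, h2⟩
      · simp
      · exact absurd ⟨h1, h2⟩ hn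
    have hF0 : z - η₁ • d ∉ U → ¬ (z - η₂ • d ∈ U ∧ η₂ < t) → #F = 0 := by
      intro hn1 hn2
      rw [card_eq_zero, eq_empty_iff_forall_notMem]
      intro k hk
      rcases hFsub k hk with ⟨rfl, h⟩ | ⟨rfl, h1, h2⟩
      · exact hn1 h
      · exact hn2 ⟨h1, h2⟩
    have hminf : min t L ≤ t ∧ min t L ≤ L ∧ (min t L = t ∨ min t L = L) :=
      ⟨min_le_left _ _, min_le_right _ _, by
        rcases le_total t L with h | h
        · exact Or.inl (min_eq_left h)
        · exact Or.inr (min_eq_right h)⟩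
    -- the constraints
    have h1 : z - η₁ • d ∈ U → η₁ < t := by
      intro hP1
      by_contra hle
      push Not at hle
      rcases hle.lt_or_eq with hlt | heq
      · have hmem : z - t • d - (η₁ - t) • d ∈ U := by
          rw [sub_nsmul_sub_nsmul, Nat.add_sub_cancel' hlt.le]; exact hP1
        rcases hHole _ hw (η₁ - t) (by omega) hmem with h | h <;> omega
      · exact hwU (by rw [heq]; exact hP1)
    have h2 : z - η₂ • d ∈ U → η₂ < t ∨ (t = g ∧ z - t • d - η₁ • d ∈ U) := by
      intro hP2
      by_contra hcon
      push Not at hcon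
      obtain ⟨hle, hng⟩ := hcon
      rcases hle.lt_or_eq with hlt | heq
      · have hmem : z - t • d - (η₂ - t) • d ∈ U := by
          rw [sub_nsmul_sub_nsmul, Nat.add_sub_cancel' hlt.le]; exact hP2
        rcases hHole _ hw (η₂ - t) (by omega) hmem with h | h
        · have htg : t = g := by omega
          refine hng htg ?_
          rw [← h]; exact hmem
        · omega
      · exact hwU (by rw [← heq] at hP2; exact hP2)
    have h3 : z - t • d - η₁ • d ∈ U → L ≤ t + η₁ ∨ (t = g ∧ z - η₂ • d ∈ U) := by
      intro hQ1
      by_contra hcon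
      push Not at hcon
      obtain ⟨hlt, hng⟩ := hcon
      have hmem : z - (t + η₁) • d ∈ U := by rw [← sub_nsmul_sub_nsmul]; exact hQ1
      rcases hHole z hz (t + η₁) hlt hmem with h | h
      · omega
      · have htg : t = g := by omega
        refine hng htg ?_
        rw [← h]; exact hmem
    have h4 : z - t • d - η₂ • d ∈ U → L ≤ t + η₂ := by
      intro hQ2
      by_contra hlt
      push Not at hlt
      have hmem : z - (t + η₂) • d ∈ U := by rw [← sub_nsmul_sub_nsmul]; exact hQ2
      rcases hHole z hz (t + η₂) hlt hmem with h | h <;> omega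
    have h5 : t = g → (z - t • d - η₁ • d ∈ U ↔ z - η₂ • d ∈ U) := by
      intro htg
      rw [sub_nsmul_sub_nsmul, htg, hg, Nat.sub_add_cancel hη.le]
    have hPz := hP z hz
    have hPw := hP _ hw
    have hη22 : η₂ + 2 ≤ L := by omega
    have hη11 : 1 ≤ η₁ := by omega
    have hn2 : min t L ≤ ν z + 2 := by omega
    have hn1a : z - η₁ • d ∉ U → min t L ≤ ν z + 1 := fun h => by have := hF1a h; omega
    have hn1b : ¬ (z - η₂ • d ∈ U ∧ η₂ < t) → min t L ≤ ν z + 1 := fun h => by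
      have := hF1b h; omega
    have hn0 : z - η₁ • d ∉ U → ¬ (z - η₂ • d ∈ U ∧ η₂ < t) → min t L ≤ ν z := fun h h' => by
      have := hF0 h h'; omega
    have hμf : a ≤ μ ∧ b ≤ μ ∧ (μ = a ∨ μ = b) := by
      rw [hμ]
      refine ⟨le_max_left _ _, le_max_right _ _, ?_⟩
      rcases le_total a b with h | h
      · exact Or.inr (max_eq_right h)
      · exact Or.inl (max_eq_left h)
    have hρf : a + g ≤ ρ ∧ b ≤ ρ ∧ (ρ = a + g ∨ ρ = b) := by
      rw [hρ]
      refine ⟨le_max_left _ _, le_max_right _ _, ?_⟩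
      rcases le_total (a + g) b with h | h
      · exact Or.inr (max_eq_right h)
      · exact Or.inl (max_eq_left h)
    have hιf : (g = μ ∧ ι = 1) ∨ (g ≠ μ ∧ ι = 0) := by
      by_cases h : g = μ
      · exact Or.inl ⟨h, by rw [hι, if_pos h]⟩
      · exact Or.inr ⟨h, by rw [hι, if_neg h]⟩
    have hΔf : (a ≤ g ∧ Δ = 2 * (ι : ℤ) - 2) ∨ (g < a ∧ Δ = 2 * (ρ : ℤ) - μ - g - 3) := by
      by_cases h : a ≤ g
      · exact Or.inl ⟨h, by rw [hΔ, if_pos h]⟩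
      · exact Or.inr ⟨by omega, by rw [hΔ, if_neg h]⟩
    have hstep := step_ineq (n := ν z) (P1 := z - η₁ • d ∈ U) (P2 := z - η₂ • d ∈ U)
      (Q1 := z - t • d - η₁ • d ∈ U) (Q2 := z - t • d - η₂ • d ∈ U)
      ha hb hg hη hη22 hη11 hμf hρf hιf hΔf hC hΦ2 hΦ12 hminf hPz hPw h1 h2 h3 h4 h5
      hn2 hn1a hn1b hn0
    simpa only [hΦ] using hstep
  -- summation
  have hsumΦ := sum_pred_eq (W := W) (d := d) Φ
  have hwin := sum_card_windows_le (W := W) hd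
    (fun z => (range (min (backDist W d z) L)).filter fun k => z - k • d ∉ U)
    (fun z hz k hk => lt_of_lt_of_le (mem_range.1 (mem_filter.1 hk).1) (min_le_left _ _))
    (univ \ U) (fun z hz k hk => by
      rw [mem_sdiff]; exact ⟨mem_univ _, (mem_filter.1 hk).2⟩)
  have hhigh : #(univ \ U) ≤ D + #V + 1 := by
    rw [card_compl_eq]
    have : #(U + V) + D = p := by rw [hDdef, hW]; exact card_add_card_missing U V
    omega
  have hνsum : (∑ z ∈ W, (ν z : ℤ)) ≤ (D : ℤ) + #V + 1 := by
    have h := hwin.trans hhigh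
    have e : (∑ z ∈ W, (ν z : ℤ)) = ((∑ z ∈ W, ν z : ℕ) : ℤ) := by push_cast; rfl
    rw [e]; exact_mod_cast h
  have hs := sum_le_sum main
  have hlhs : (∑ z ∈ W, C) = (D : ℤ) * C := by rw [sum_const, nsmul_eq_mul, ← hDdef]
  have hrhs : (∑ z ∈ W, (2 * ((ν z : ℤ) - 1) + Φ (z - backDist W d z • d) - Φ z)) =
      2 * (∑ z ∈ W, (ν z : ℤ)) - 2 * D := by
    rw [sum_sub_distrib, sum_add_distrib, hsumΦ, add_sub_cancel_right, ← mul_sum,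
      sum_sub_distrib, sum_const, nsmul_eq_mul, mul_one, ← hDdef]
    ring
  rw [hlhs, hrhs] at hs
  have htotal : (D : ℤ) * C ≤ 2 * (#V : ℤ) + 2 := by linarith
  -- arithmetic
  have hμf : a ≤ μ ∧ b ≤ μ ∧ (μ = a ∨ μ = b) := by
    rw [hμ]
    refine ⟨le_max_left _ _, le_max_right _ _, ?_⟩
    rcases le_total a b with h | h
    · exact Or.inr (max_eq_right h)
    · exact Or.inl (max_eq_left h)
  have hιf : (g = μ ∧ ι = 1) ∨ (g ≠ μ ∧ ι = 0) := by
    by_cases h : g = μ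
    · exact Or.inl ⟨h, by rw [hι, if_pos h]⟩
    · exact Or.inr ⟨h, by rw [hι, if_neg h]⟩
  have hCnn : 0 ≤ C := by rw [hC]; omega
  have hL6 : a + b + g = L + 1 := by omega
  rcases hD with h11 | ⟨h17, h5⟩
  · have h11' : (11 : ℤ) ≤ D := by exact_mod_cast h11
    have : 11 * C ≤ (D : ℤ) * C := mul_le_mul_of_nonneg_right h11' hCnn
    omega
  · have h5' : (5 : ℤ) ≤ D := by exact_mod_cast h5
    have : 5 * C ≤ (D : ℤ) * C := mul_le_mul_of_nonneg_right h5' hCnn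
    omega

/-- The hole indices of `V ⊆ {0, d, …, (L−1)d}`: `#holes + |V| = L` (`L ≤ p`).
[cite: HamidouneSerraZemor2006, §3 (before Lemma 13: «`Y = Y_1 ∪ Y_2 ∪ Y_3`», `ℓ(Y) = |Y| + 2`)] -/
theorem card_holes_add_card {V : Finset (ZMod p)} {d : ZMod p} (hd : d ≠ 0) {L : ℕ} (hLp : L ≤ p)
    (hV : V ⊆ apFinset 0 d L) :
    #((range L).filter fun k => k • d ∉ V) + #V = L := by
  classical
  have hVeq : V = ((range L).filter fun k => k • d ∈ V).image fun k : ℕ => k • d := by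
    ext v
    rw [mem_image]
    constructor
    · intro hv
      obtain ⟨k, hk, hkv⟩ := mem_apFinset.1 (hV hv)
      rw [zero_add] at hkv
      exact ⟨k, mem_filter.2 ⟨mem_range.2 hk, by rw [hkv]; exact hv⟩, hkv⟩
    · rintro ⟨k, hk, rfl⟩
      exact (mem_filter.1 hk).2
  have hcardV : #V = #((range L).filter fun k => k • d ∈ V) := by
    conv_lhs => rw [hVeq]
    rw [card_image_of_injOn]
    intro i hi j hj hij
    have hi' := mem_range.1 (mem_filter.1 hi).1
    have hj' := mem_range.1 (mem_filter.1 hj).1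
    exact HamidouneRodseth.nat_eq_of_nsmul_eq hd (by omega) (by omega) hij
  rw [hcardV, add_comm]
  have := card_filter_add_card_filter_not (s := range L) (fun k => k • d ∈ V)
  rw [card_range] at this
  exact this

/-- **No missing point under the standing assumption «`|C_j| < ℓ(Y) − 1`» (Lemmas 12–13
combined).**  If `V ⊆ {0, d, …, (L−1)d}` contains `0` and `(L−1)d`, `|V| ≥ 4`, `L ≤ |V| + 2`,
`|U + V| ≤ |U| + |V| + 1`, every `d`-progression with `L − 1` terms meets `U`, and the number `D`
of missing points satisfies `D ≥ 11` or (`L ≥ 17` and `D ≥ 5`), we reach a contradiction: the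
number of holes of `V` is `L − |V| ∈ {0, 1, 2}`; no hole contradicts the existence of a missing
point (`exists_hole_of_missing`: the case `ℓ(Y) = |Y|` of Lemma 12), one hole is
`false_of_one_hole`, two holes `false_of_two_holes`. [cite: HamidouneSerraZemor2006, Lemmas 12–13] -/
theorem false_of_runs_meet {U V : Finset (ZMod p)} {d : ZMod p} (hd : d ≠ 0) {L : ℕ} (hLp : L ≤ p)
    (hV : V ⊆ apFinset 0 d L) (h0 : (0 : ZMod p) ∈ V) (hlast : (L - 1) • d ∈ V) (hV4 : 4 ≤ #V)
    (hLV : L ≤ #V + 2) (hB : ∀ c : ZMod p, ∃ x ∈ U, x ∈ apFinset c d (L - 1))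
    (hUV : #(U + V) ≤ #U + #V + 1)
    (hD : 11 ≤ #(univ \ (U + V)) ∨ (17 ≤ L ∧ 5 ≤ #(univ \ (U + V)))) : False := by
  classical
  set H := (range L).filter fun k => k • d ∉ V with hH
  have hcard := card_holes_add_card hd hLp hV
  rw [← hH] at hcard
  have hmemH : ∀ {k}, k ∈ H ↔ k < L ∧ k • d ∉ V := fun {k} => by rw [hH, mem_filter, mem_range]
  -- a missing point and a hole
  have hDpos : 0 < #(univ \ (U + V)) := by rcases hD with h | ⟨-, h⟩ <;> omega
  obtain ⟨z, hz⟩ := card_pos.1 hDpos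
  have hzUV : z ∉ U + V := (mem_sdiff.1 hz).2
  obtain ⟨k₀, hk₀0, hk₀L, hk₀V, -⟩ := exists_hole_of_missing hB hzUV
  have hH1 : 1 ≤ #H := card_pos.2 ⟨k₀, hmemH.2 ⟨hk₀L, hk₀V⟩⟩
  have hH2 : #H ≤ 2 := by omega
  rcases Nat.lt_or_ge #H 2 with hlt | hge
  · -- one hole
    obtain ⟨η, hHη⟩ := card_eq_one.1 (by omega : #H = 1)
    have hη := hmemH.1 (by rw [hHη]; exact mem_singleton_self η)
    exact false_of_one_hole hd h0 hlast hV4 (by rw [hHη, card_singleton] at hcard; omega) hη.1 hη.2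
      (fun k hkL hkV => by
        have : k ∈ H := hmemH.2 ⟨hkL, hkV⟩
        rw [hHη, mem_singleton] at this; exact this) hB hUV hD
  · -- two holes
    obtain ⟨x, y, hxy, hHxy⟩ := card_eq_two.1 (by omega : #H = 2)
    have hx : x < L ∧ x • d ∉ V := hmemH.1 (by rw [hHxy]; exact mem_insert_self _ _)
    have hy : y < L ∧ y • d ∉ V :=
      hmemH.1 (by rw [hHxy]; exact mem_insert_of_mem (mem_singleton_self _))
    have hVL : #V + 2 = L := by rw [hHxy, card_pair hxy] at hcard; omega
    have huniq : ∀ k : ℕ, k < L → k • d ∉ V → k = x ∨ k = y := fun k hkL hkV => by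
      have : k ∈ H := hmemH.2 ⟨hkL, hkV⟩
      rw [hHxy, mem_insert, mem_singleton] at this; exact this
    rcases lt_or_gt_of_ne hxy with h | h
    · exact false_of_two_holes hd h0 hlast hV4 hVL h hy.1 hx.2 hy.2 huniq hB hUV hD
    · exact false_of_two_holes hd h0 hlast hV4 hVL h hx.1 hy.2 hx.2
        (fun k hkL hkV => (huniq k hkL hkV).symm) hB hUV hD

/-- With the standing data, `V` has at least one hole: `|V| + 1 ≤ L`, as soon as there is a
missing point. [cite: HamidouneSerraZemor2006, Lemma 12 (case `ℓ(Y) = |Y|`)] -/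
theorem card_lt_of_runs_meet {U V : Finset (ZMod p)} {d : ZMod p} (hd : d ≠ 0) {L : ℕ} (hLp : L ≤ p)
    (hV : V ⊆ apFinset 0 d L) (hB : ∀ c : ZMod p, ∃ x ∈ U, x ∈ apFinset c d (L - 1))
    {z : ZMod p} (hz : z ∉ U + V) : #V + 1 ≤ L := by
  classical
  have hcard := card_holes_add_card hd hLp hV
  obtain ⟨k₀, -, hk₀L, hk₀V, -⟩ := exists_hole_of_missing hB hz
  have : 1 ≤ #((range L).filter fun k => k • d ∉ V) :=
    card_pos.2 ⟨k₀, mem_filter.2 ⟨mem_range.2 hk₀L, hk₀V⟩⟩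
  omega

/-- **No three consecutive missing points.**  With the standing data (every `(L−1)`-run meets
`U`, `V ⊆ {0, …, (L−1)d}` with at most two holes, `0 ∈ V`), no `z` has `z`, `z − d`, `z − 2d` all
missing: the point of `U` provided for `z` sits at a hole index `k ≥ 3`, and then `k − 1`, `k − 2`
are holes too.  (In the paper: a deficient gap is preceded by an `X`-run of length `≤ 2`, so missing
points come in blocks of length `≤ 2`.) [cite: HamidouneSerraZemor2006, Lemma 13 (display (6))] -/
theorem not_three_consecutive_missing {U V : Finset (ZMod p)} {d : ZMod p} (hd : d ≠ 0) {L : ℕ}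
    (hLp : L ≤ p) (hV : V ⊆ apFinset 0 d L) (h0 : (0 : ZMod p) ∈ V) (hLV : L ≤ #V + 2)
    (hB : ∀ c : ZMod p, ∃ x ∈ U, x ∈ apFinset c d (L - 1)) {z : ZMod p} (hz : z ∉ U + V)
    (hz1 : z - d ∉ U + V) (hz2 : z - 2 • d ∉ U + V) : False := by
  classical
  have hcard := card_holes_add_card hd hLp hV
  obtain ⟨k, hk0, hkL, hkV, hkU⟩ := exists_hole_of_missing hB hz
  have hk1 : k ≠ 1 := by
    rintro rfl
    exact not_mem_of_missing h0 hz1 (by simpa using hkU)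
  have hk2 : k ≠ 2 := by
    rintro rfl
    exact not_mem_of_missing h0 hz2 hkU
  have hkV1 : (k - 1) • d ∉ V := fun hV1 =>
    sub_not_mem_of_missing hz1 hV1 (by
      rw [show z - d - (k - 1) • d = z - k • d by
        rw [sub_sub, ← succ_nsmul', Nat.sub_add_cancel (by omega)]]
      exact hkU)
  have hkV2 : (k - 2) • d ∉ V := fun hV2 =>
    sub_not_mem_of_missing hz2 hV2 (by
      rw [show z - 2 • d - (k - 2) • d = z - k • d by
        rw [sub_sub, ← add_nsmul, Nat.add_sub_cancel' (by omega)]]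
      exact hkU)
  have h3 : ({k, k - 1, k - 2} : Finset ℕ) ⊆ (range L).filter fun k => k • d ∉ V := by
    intro j hj
    simp only [mem_insert, mem_singleton] at hj
    rw [mem_filter, mem_range]
    rcases hj with rfl | rfl | rfl
    · exact ⟨hkL, hkV⟩
    · exact ⟨by omega, hkV1⟩
    · exact ⟨by omega, hkV2⟩
  have hc3 : #({k, k - 1, k - 2} : Finset ℕ) = 3 := by
    rw [card_insert_of_notMem (by simp; omega), card_pair (by omega)]
  have := card_le_card h3
  omega

end Holes

/-! ## Normalisations: the hull of a set in a progression, complements of runs, reflection -/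

section Normalise

variable {p : ℕ} [hp : Fact p.Prime]

/-- Shrinking a progression containing `Y ≠ ∅` to the HULL of `Y`: both end terms in `Y`.
(«`ℓ_r(X)` denotes the cardinality of the smallest arithmetic progression with difference `r`
containing `X`».) [cite: HamidouneSerraZemor2006, §1.1 (definition of ℓ_r)] -/
theorem exists_tight_apFinset {Y : Finset (ZMod p)} (hY : Y.Nonempty) {y d : ZMod p} :
    ∀ {n : ℕ}, Y ⊆ apFinset y d n →
      ∃ y' : ZMod p, ∃ L : ℕ, 1 ≤ L ∧ L ≤ n ∧ Y ⊆ apFinset y' d L ∧ y' ∈ Y ∧ y' + (L - 1) • d ∈ Y := by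
  intro n
  induction n using Nat.strong_induction_on generalizing y with
  | _ n ih =>
  intro hYn
  have hn : 1 ≤ n := by
    by_contra h
    rw [show n = 0 by omega, apFinset_zero] at hYn
    exact hY.ne_empty (subset_empty.1 hYn)
  by_cases hy : y ∈ Y
  · by_cases hlast : y + (n - 1) • d ∈ Y
    · exact ⟨y, n, hn, le_rfl, hYn, hy, hlast⟩
    · -- drop the last term
      have hsub : Y ⊆ apFinset y d (n - 1) := by
        intro x hx
        obtain ⟨i, hi, hix⟩ := mem_apFinset.1 (hYn hx)
        have hin : i ≠ n - 1 := by rintro rfl; exact hlast (by rw [hix]; exact hx)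
        exact mem_apFinset.2 ⟨i, by omega, hix⟩
      obtain ⟨y', L, hL1, hLn, h⟩ := ih (n - 1) (by omega) hsub
      exact ⟨y', L, hL1, by omega, h⟩
  · -- drop the first term
    have hsub : Y ⊆ apFinset (y + d) d (n - 1) := by
      intro x hx
      obtain ⟨i, hi, hix⟩ := mem_apFinset.1 (hYn hx)
      have hi0 : i ≠ 0 := by
        rintro rfl
        rw [zero_nsmul, add_zero] at hix
        exact hy (by rw [hix]; exact hx)
      refine mem_apFinset.2 ⟨i - 1, by omega, ?_⟩
      rw [← hix, add_assoc, ← succ_nsmul', Nat.sub_add_cancel (by omega)]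
    obtain ⟨y', L, hL1, hLn, h⟩ := ih (n - 1) (by omega) hsub
    exact ⟨y', L, hL1, by omega, h⟩

/-- Every element of `ℤ/pℤ` is `c + i d` for some `i < p` (`d ≠ 0`). [folklore] -/
private theorem exists_eq_add_nsmul {d : ZMod p} (hd : d ≠ 0) (c x : ZMod p) :
    ∃ i : ℕ, i < p ∧ x = c + i • d := by
  refine ⟨((x - c) * d⁻¹).val, ZMod.val_lt _, ?_⟩
  rw [nsmul_eq_mul, ZMod.natCast_zmod_val, mul_assoc, inv_mul_cancel₀ hd, mul_one]
  ring

/-- The complement of a `d`-run with `n ≤ p` terms is the `d`-run with `p − n` terms starting right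
after it. [folklore] -/
private theorem mem_apFinset_of_not_mem {d : ZMod p} (hd : d ≠ 0) {c x : ZMod p} {n : ℕ}
    (hx : x ∉ apFinset c d n) : x ∈ apFinset (c + n • d) d (p - n) := by
  obtain ⟨i, hip, rfl⟩ := exists_eq_add_nsmul hd c x
  have hin : n ≤ i := by
    by_contra h
    exact hx (mem_apFinset.2 ⟨i, by omega, rfl⟩)
  refine mem_apFinset.2 ⟨i - n, by omega, ?_⟩
  rw [add_assoc, ← add_nsmul, Nat.add_sub_cancel' hin]

/-- The position of a point of a `d`-run: for `w ∈ {c + i d : i < n}` (`n ≤ p`, `d ≠ 0`) the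
number `((w − c) d⁻¹).val` is that `i`. [folklore] -/
private theorem pos_spec {d c w : ZMod p} (hd : d ≠ 0) {n : ℕ} (hn : n ≤ p) (hw : w ∈ apFinset c d n) :
    ((w - c) * d⁻¹).val < n ∧ w = c + ((w - c) * d⁻¹).val • d := by
  obtain ⟨i, hi, rfl⟩ := mem_apFinset.1 hw
  have h : (c + i • d - c) * d⁻¹ = (i : ZMod p) := by
    rw [add_sub_cancel_left, nsmul_eq_mul, mul_assoc, mul_inv_cancel₀ hd, mul_one]
  rw [h, ZMod.val_natCast, Nat.mod_eq_of_lt (by omega)]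
  exact ⟨hi, rfl⟩

/-- A set and its translate by the step stay in a progression one term longer. [folklore] -/
private theorem union_vadd_subset_apFinset {W : Finset (ZMod p)} {c f : ZMod p} {n : ℕ}
    (hW : W ⊆ apFinset c f n) : W ∪ (f +ᵥ W) ⊆ apFinset c f (n + 1) := by
  intro x hx
  rw [mem_union, mem_vadd_finset] at hx
  rcases hx with hx | ⟨w, hw, rfl⟩
  · obtain ⟨i, hi, rfl⟩ := mem_apFinset.1 (hW hx)
    exact mem_apFinset.2 ⟨i, by omega, rfl⟩
  · obtain ⟨i, hi, rfl⟩ := mem_apFinset.1 (hW hw)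
    refine mem_apFinset.2 ⟨i + 1, by omega, ?_⟩
    rw [vadd_eq_add, succ_nsmul]; abel

/-- Translates inside one run: if `W ⊆ {c, c + d, …, c + (n−1)d}` (`2n ≤ p`) and `w₁, w₁ − f ∈ W`,
then `f = u·d` for an integer `0 < |u| < n` (if `f ≠ 0`), every `w ∈ W ∩ (f + W)` has position
`≥ u` (resp. `< n + u`), and so `|W ∩ (f + W)| ≤ n − |u|`. [folklore] -/
private theorem exists_int_of_vadd_inter {W : Finset (ZMod p)} {c d f : ZMod p} (hd : d ≠ 0) (hf : f ≠ 0)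
    {n : ℕ} (h2n : 2 * n ≤ p) (hW : W ⊆ apFinset c d n) {w₁ : ZMod p} (hw₁ : w₁ ∈ W)
    (hw₁' : w₁ - f ∈ W) :
    ∃ u : ℤ, u ≠ 0 ∧ f = (u : ZMod p) * d ∧ #(W ∩ (f +ᵥ W)) + u.natAbs ≤ n := by
  classical
  have hn : n ≤ p := by omega
  -- positions
  set pos : ZMod p → ℕ := fun w => ((w - c) * d⁻¹).val with hpos
  have hposW : ∀ w ∈ W, pos w < n ∧ w = c + pos w • d := fun w hw => pos_spec hd hn (hW hw)
  -- the integer `u`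
  obtain ⟨hk₁, hw₁eq⟩ := hposW w₁ hw₁
  obtain ⟨hk₂, hw₂eq⟩ := hposW _ hw₁'
  set u : ℤ := (pos w₁ : ℤ) - pos (w₁ - f) with hu
  have hfu : f = (u : ZMod p) * d := by
    have e1 : f = (c + pos w₁ • d) - (c + pos (w₁ - f) • d) := by
      rw [← hw₁eq, ← hw₂eq]; ring
    rw [e1, hu]; push_cast; rw [nsmul_eq_mul, nsmul_eq_mul]; ring
  have hu0 : u ≠ 0 := by
    rintro h0
    rw [h0, Int.cast_zero, zero_mul] at hfu
    exact hf hfu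
  refine ⟨u, hu0, hfu, ?_⟩
  -- every `w ∈ W ∩ (f + W)` has `pos (w − f) = pos w − u`
  have hshift : ∀ w ∈ W ∩ (f +ᵥ W), (pos w : ℤ) - u = pos (w - f) := by
    intro w hw
    rw [mem_inter, mem_vadd_finset] at hw
    obtain ⟨hwW, w', hw', hww'⟩ := hw
    have hwf : w - f ∈ W := by rw [← hww', vadd_eq_add, add_sub_cancel_left]; exact hw'
    obtain ⟨hk, hweq⟩ := hposW w hwW
    obtain ⟨hk', hweq'⟩ := hposW _ hwf
    -- `f = (pos w − pos (w − f)) • d` as well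
    have hfu' : f = ((pos w : ℤ) - pos (w - f) : ℤ) * d := by
      have e1 : f = (c + pos w • d) - (c + pos (w - f) • d) := by
        rw [← hweq, ← hweq']; ring
      calc f = (c + pos w • d) - (c + pos (w - f) • d) := e1
        _ = _ := by push_cast; rw [nsmul_eq_mul, nsmul_eq_mul]; ring
    have hdiff : (((pos w : ℤ) - pos (w - f) - u : ℤ) : ZMod p) = 0 := by
      have := hfu'.symm.trans hfu
      have h2 : (((pos w : ℤ) - pos (w - f) : ℤ) : ZMod p) = (u : ZMod p) := mul_right_cancel₀ hd this
      rw [Int.cast_sub, h2, sub_self]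
    rw [ZMod.intCast_zmod_eq_zero_iff_dvd] at hdiff
    have hsmall : ((pos w : ℤ) - pos (w - f) - u).natAbs < p := by
      rw [hu]; omega
    have := Int.eq_zero_of_dvd_of_natAbs_lt_natAbs hdiff (by simpa using hsmall)
    omega
  -- hence the positions of `W ∩ (f + W)` lie in an interval of length `n − |u|`
  have hinj : Set.InjOn pos ((W ∩ (f +ᵥ W) : Finset (ZMod p)) : Set (ZMod p)) := by
    intro w hw w' hw' h
    rw [mem_coe] at hw hw'
    have e1 := (hposW w (mem_inter.1 hw).1).2
    have e2 := (hposW w' (mem_inter.1 hw').1).2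
    rw [e1, e2, h]
  have hsub : (W ∩ (f +ᵥ W)).image pos ⊆
      (range n).filter fun k : ℕ => (0 : ℤ) ≤ (k : ℤ) - u ∧ (k : ℤ) - u < n := by
    intro k hk
    rw [mem_image] at hk
    obtain ⟨w, hw, rfl⟩ := hk
    have hwW := (mem_inter.1 hw).1
    have h1 := hshift w hw
    have hwf : w - f ∈ W := by
      have := (mem_inter.1 hw).2
      rw [mem_vadd_finset] at this
      obtain ⟨w', hw', hww'⟩ := this
      rw [← hww', vadd_eq_add, add_sub_cancel_left]; exact hw'
    have hk' := (hposW _ hwf).1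
    rw [mem_filter, mem_range]
    refine ⟨(hposW w hwW).1, by omega, by omega⟩
  have hcardF : #((range n).filter fun k : ℕ => (0 : ℤ) ≤ (k : ℤ) - u ∧ (k : ℤ) - u < n) +
      u.natAbs ≤ n := by
    rcases le_or_gt 0 u with hu' | hu'
    · have hsub' : ((range n).filter fun k : ℕ => (0 : ℤ) ≤ (k : ℤ) - u ∧ (k : ℤ) - u < n) ⊆
          range n \ range u.natAbs := by
        intro k hk
        rw [mem_filter, mem_range] at hk
        rw [mem_sdiff, mem_range, mem_range]
        omega
      have := card_le_card hsub'
      rw [card_sdiff_of_subset (range_subset_range.2 (by omega)), card_range, card_range] at this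
      omega
    · have hsub' : ((range n).filter fun k : ℕ => (0 : ℤ) ≤ (k : ℤ) - u ∧ (k : ℤ) - u < n) ⊆
          range (n - u.natAbs) := by
        intro k hk
        rw [mem_filter, mem_range] at hk
        rw [mem_range]
        omega
      have := card_le_card hsub'
      rw [card_range] at this
      omega
  have := card_le_card hsub
  rw [card_image_of_injOn hinj] at this
  omega

/-- **Two progressions containing a dense set have the same difference up to sign** (the «easy
half», no wrap-around: `2L ≤ p`).  If `V` (`|V| ≥ 4`) lies in a `d`-progression with `L ≤ |V| + 2`
terms and in an `e`-progression with `|V| + 1` terms, then `e = ±d`: `V ∩ (V + e)` has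
`≥ |V| − 2` points, forcing `e = u d` with `|u| ≤ 4`; `V ∩ (V + d)` has `≥ |V| − 3 ≥ 1` points,
forcing `d = s e` with `|s| ≤ 4`; and `s u ≡ 1 (mod p)` with `|s u| ≤ 16 < p`.  (Supplement, ours;
used to compare the progressions delivered by Vosper's / Hamidoune–Rødseth's theorems with the
`d`-progression containing `Y` in the final step of Theorem 10.) [folklore] -/
private theorem eq_or_eq_neg_of_two_progressions {V : Finset (ZMod p)} {d e b : ZMod p} (hd : d ≠ 0)
    (he : e ≠ 0) {L : ℕ} (hVd : V ⊆ apFinset 0 d L) (hVe : V ⊆ apFinset b e (#V + 1))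
    (hV4 : 4 ≤ #V) (hLV : L ≤ #V + 2) (h2L : 2 * (#V + 2) ≤ p) (hp17 : 17 < p) :
    e = d ∨ e = -d := by
  classical
  have hL : #V ≤ L := by
    have := card_le_card hVd
    exact this.trans (card_apFinset_le _ _ _)
  -- `|V ∩ (e + V)| ≥ |V| − 2`
  have hinter_e : #V ≤ #(V ∩ (e +ᵥ V)) + 2 := by
    have h1 := card_union_add_card_inter V (e +ᵥ V)
    have h2 : #(V ∪ (e +ᵥ V)) ≤ #V + 2 :=
      (card_le_card (union_vadd_subset_apFinset hVe)).trans (card_apFinset_le _ _ _)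
    rw [card_vadd_finset] at h1
    omega
  have hinter_d : #V ≤ #(V ∩ (d +ᵥ V)) + 3 := by
    have h1 := card_union_add_card_inter V (d +ᵥ V)
    have h2 : #(V ∪ (d +ᵥ V)) ≤ L + 1 :=
      (card_le_card (union_vadd_subset_apFinset hVd)).trans (card_apFinset_le _ _ _)
    rw [card_vadd_finset] at h1
    omega
  -- witnesses
  obtain ⟨w₁, hw₁⟩ : (V ∩ (e +ᵥ V)).Nonempty := card_pos.1 (by omega)
  obtain ⟨w₂, hw₂⟩ : (V ∩ (d +ᵥ V)).Nonempty := card_pos.1 (by omega)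
  have hmem : ∀ {f w}, w ∈ V ∩ (f +ᵥ V) → w ∈ V ∧ w - f ∈ V := fun {f w} hw => by
    rw [mem_inter, mem_vadd_finset] at hw
    obtain ⟨hwV, w', hw', hww'⟩ := hw
    exact ⟨hwV, by rw [← hww', vadd_eq_add, add_sub_cancel_left]; exact hw'⟩
  obtain ⟨u, hu0, heu, hcu⟩ := exists_int_of_vadd_inter hd he (n := L) (by omega) hVd
    (hmem hw₁).1 (hmem hw₁).2
  obtain ⟨t, ht0, hdt, hct⟩ := exists_int_of_vadd_inter he hd (n := #V + 1) (by omega) hVe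
    (hmem hw₂).1 (hmem hw₂).2
  have hu4 : u.natAbs ≤ 4 := by omega
  have ht4 : t.natAbs ≤ 4 := by omega
  -- `t u ≡ 1 (mod p)` with `|t u| ≤ 16`
  have hprod : (((t * u - 1 : ℤ)) : ZMod p) = 0 := by
    have h : d = ((t * u : ℤ) : ZMod p) * d := by
      nth_rw 1 [hdt, heu]; push_cast; ring
    have h' : (((t * u : ℤ) : ZMod p) - 1) * d = 0 := by
      rw [sub_mul, one_mul, ← h, sub_self]
    rcases mul_eq_zero.1 h' with h'' | h''
    · rw [Int.cast_sub, Int.cast_one]; exact h''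
    · exact absurd h'' hd
  rw [ZMod.intCast_zmod_eq_zero_iff_dvd] at hprod
  have hsmall : (t * u - 1).natAbs < p := by
    have : (t * u).natAbs ≤ 16 := by
      rw [Int.natAbs_mul]; exact (Nat.mul_le_mul ht4 hu4).trans (by norm_num)
    omega
  have h1 : t * u - 1 = 0 := Int.eq_zero_of_dvd_of_natAbs_lt_natAbs hprod (by simpa using hsmall)
  rcases Int.eq_one_or_neg_one_of_mul_eq_one' (by linarith : t * u = 1) with ⟨-, h⟩ | ⟨-, h⟩
  · left; rw [heu, h, Int.cast_one, one_mul]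
  · right; rw [heu, h, Int.cast_neg, Int.cast_one, neg_one_mul]

end Normalise

/-! ### Theorem 10: the assembly -/

section Assembly

variable {p : ℕ} [hp : Fact p.Prime]

/-- The reflection `v ↦ (L−1)d − v` of a hull-normalised `V ⊆ {0, d, …, (L−1)d}` (both ends in `V`)
is again hull-normalised, with the same number of points («by using multiplication by `−1` and
translating if necessary»). [cite: HamidouneSerraZemor2006, §3 (proof of Lemma 12)] -/
theorem exists_reflection {V : Finset (ZMod p)} {d : ZMod p} {L : ℕ} (hV : V ⊆ apFinset 0 d L)
    (h0 : (0 : ZMod p) ∈ V) (hlast : (L - 1) • d ∈ V) :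
    ∃ N : Finset (ZMod p), N ⊆ apFinset 0 d L ∧ (0 : ZMod p) ∈ N ∧ (L - 1) • d ∈ N ∧ #N = #V ∧
      ∀ x, x ∈ N ↔ (L - 1) • d - x ∈ V := by
  classical
  refine ⟨V.image fun v => (L - 1) • d - v, ?_, ?_, ?_, ?_, ?_⟩
  · intro x hx
    rw [mem_image] at hx
    obtain ⟨v, hv, rfl⟩ := hx
    obtain ⟨i, hi, hiv⟩ := mem_apFinset.1 (hV hv)
    rw [zero_add] at hiv
    obtain ⟨j, hj⟩ : ∃ j, L - 1 = i + j := ⟨L - 1 - i, by omega⟩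
    refine mem_apFinset.2 ⟨j, by omega, ?_⟩
    rw [zero_add, ← hiv, hj, add_nsmul, add_sub_cancel_left]
  · exact mem_image.2 ⟨(L - 1) • d, hlast, sub_self _⟩
  · exact mem_image.2 ⟨0, h0, sub_zero _⟩
  · exact card_image_of_injective _ sub_right_injective
  · intro x
    rw [mem_image]
    constructor
    · rintro ⟨v, hv, rfl⟩
      rwa [sub_sub_cancel]
    · intro hx
      exact ⟨(L - 1) • d - x, hx, sub_sub_cancel _ _⟩

/-- Outside a `d`-progression `T` with `m + 3 ≤ p` terms a point has its predecessor outside `T`, or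
its two successors outside `T` (the complement of `T` is a `d`-run with at least three terms).
[folklore] -/
private theorem apFinset_compl_step {d t₀ x : ZMod p} (hd : d ≠ 0) {m : ℕ} (hm : m + 3 ≤ p)
    (hx : x ∉ apFinset t₀ d m) :
    x - d ∉ apFinset t₀ d m ∨ (x + d ∉ apFinset t₀ d m ∧ x + 2 • d ∉ apFinset t₀ d m) := by
  obtain ⟨i, hip, rfl⟩ := mem_apFinset.1 (mem_apFinset_of_not_mem hd hx)
  have key : ∀ j : ℕ, m ≤ j → j < p → t₀ + j • d ∉ apFinset t₀ d m := by
    intro j hmj hjp hj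
    obtain ⟨k, hk, hkj⟩ := mem_apFinset.1 hj
    have := HamidouneRodseth.nat_eq_of_nsmul_eq hd (by omega) hjp (add_left_cancel hkj)
    omega
  rcases Nat.eq_zero_or_pos i with h | h
  · subst h
    refine Or.inr ⟨?_, ?_⟩
    · have e : t₀ + m • d + 0 • d + d = t₀ + (m + 1) • d := by
        rw [zero_nsmul, add_zero, succ_nsmul, add_assoc]
      rw [e]; exact key (m + 1) (by omega) (by omega)
    · have e : t₀ + m • d + 0 • d + 2 • d = t₀ + (m + 2) • d := by
        rw [zero_nsmul, add_zero, add_nsmul, add_assoc]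
      rw [e]; exact key (m + 2) (by omega) (by omega)
  · left
    obtain ⟨i', rfl⟩ : ∃ i', i = i' + 1 := ⟨i - 1, by omega⟩
    have e : t₀ + m • d + (i' + 1) • d - d = t₀ + (m + i') • d := by
      rw [succ_nsmul, add_nsmul]; abel
    rw [e]; exact key _ (by omega) (by omega)

/-- A set filling all but at most one slot of a `d`-progression with at least six slots contains
three consecutive terms. [folklore] -/
private theorem exists_three_terms {S : Finset (ZMod p)} {a d : ZMod p} (hd : d ≠ 0) (h6 : 6 ≤ p) {n : ℕ}
    (hS : S ⊆ apFinset a d (n + 1)) (hn : n ≤ #S) (h5 : 5 ≤ n) :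
    ∃ i : ℕ, a + i • d ∈ S ∧ a + (i + 1) • d ∈ S ∧ a + (i + 2) • d ∈ S := by
  classical
  -- at most one of the first six slots is missed
  have hmiss : ∀ i j : ℕ, i < j → j < 6 → a + i • d ∉ S → a + j • d ∉ S → False := by
    intro i j hij hj6 hi hj
    have hPi : a + i • d ∈ apFinset a d (n + 1) := mem_apFinset.2 ⟨i, by omega, rfl⟩
    have hPj : a + j • d ∈ apFinset a d (n + 1) := mem_apFinset.2 ⟨j, by omega, rfl⟩
    have hne : a + j • d ≠ a + i • d := fun h => by
      have := HamidouneRodseth.nat_eq_of_nsmul_eq hd (by omega) (by omega) (add_left_cancel h)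
      omega
    have hsub : S ⊆ ((apFinset a d (n + 1)).erase (a + i • d)).erase (a + j • d) := by
      intro s hs
      rw [mem_erase, mem_erase]
      exact ⟨fun h => hj (h ▸ hs), fun h => hi (h ▸ hs), hS hs⟩
    have h1 := card_le_card hsub
    rw [card_erase_of_mem (mem_erase.2 ⟨hne, hPj⟩), card_erase_of_mem hPi] at h1
    have h2 := card_apFinset_le a d (n + 1)
    omega
  have hfill : ∀ i : ℕ, i < 3 → a + i • d ∉ S → ∀ j : ℕ, 3 ≤ j → j < 6 → a + j • d ∈ S := by
    intro i hi3 hi j hj3 hj6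
    by_contra hj
    exact hmiss i j (by omega) hj6 hi hj
  by_cases h0 : a + 0 • d ∈ S
  · by_cases h1 : a + (0 + 1) • d ∈ S
    · by_cases h2 : a + (0 + 2) • d ∈ S
      · exact ⟨0, h0, h1, h2⟩
      · exact ⟨3, hfill 2 (by norm_num) h2 3 le_rfl (by norm_num),
          hfill 2 (by norm_num) h2 (3 + 1) (by norm_num) (by norm_num),
          hfill 2 (by norm_num) h2 (3 + 2) (by norm_num) (by norm_num)⟩
    · exact ⟨3, hfill 1 (by norm_num) h1 3 le_rfl (by norm_num),
        hfill 1 (by norm_num) h1 (3 + 1) (by norm_num) (by norm_num),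
        hfill 1 (by norm_num) h1 (3 + 2) (by norm_num) (by norm_num)⟩
  · exact ⟨3, hfill 0 (by norm_num) h0 3 le_rfl (by norm_num),
      hfill 0 (by norm_num) h0 (3 + 1) (by norm_num) (by norm_num),
      hfill 0 (by norm_num) h0 (3 + 2) (by norm_num) (by norm_num)⟩

/-- **The count closing the residual case.**  Standing data: every `(L−1)`-run meets `X`,
`V ⊆ {0, …, (L−1)d}` with both ends in `V` and at most two holes, and every point of `S` is missing
from `X + V`.  If moreover every point outside a set `T` lies in `X`, and outside `T` a point always
has its predecessor or its two successors outside `T` as well, then `|S| ≤ 2 |X ∩ T|`: the point of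
`X` at `z − η d` for the LARGEST admissible hole index `η` of a missing point `z` has
`z − (η+1) d ∉ X` and one of `z − (η−1) d`, `z − (η−2) d` outside `X`, so it lies in `T`, and
`z ↦ (z − η d, η)` is injective.  (Ours; it replaces the last two sentences of the printed proof,
which invoke `|X' − Y| = |X'| + |Y| + 1` for the dual pair.) [cite: HamidouneSerraZemor2006, §3
(proof of Theorem 10, final step)] -/
theorem card_le_two_mul_card_inter {X V S T : Finset (ZMod p)} {d : ZMod p} (hd : d ≠ 0) {L : ℕ}
    (hLp : L ≤ p) (hV : V ⊆ apFinset 0 d L) (h0 : (0 : ZMod p) ∈ V) (hlast : (L - 1) • d ∈ V)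
    (hLV : L ≤ #V + 2) (hB : ∀ c : ZMod p, ∃ x ∈ X, x ∈ apFinset c d (L - 1))
    (hS : ∀ z ∈ S, z ∉ X + V) (hTX : ∀ x, x ∉ T → x ∈ X)
    (hT : ∀ x, x ∉ T → x - d ∉ T ∨ (x + d ∉ T ∧ x + 2 • d ∉ T)) :
    #S ≤ #(X ∩ T) * 2 := by
  classical
  obtain ⟨H, hH⟩ : ∃ H : Finset ℕ, H = (range L).filter fun k => k • d ∉ V := ⟨_, rfl⟩
  have hcardH : #H ≤ 2 := by
    have := card_holes_add_card hd hLp hV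
    rw [← hH] at this
    omega
  have key : ∀ z ∈ S, ∃ k ∈ H, z - k • d ∈ X ∩ T := by
    intro z hzS
    have hz := hS z hzS
    obtain ⟨k₀, -, hk₀L, hk₀V, hk₀X⟩ := exists_hole_of_missing hB hz
    obtain ⟨K, hK⟩ : ∃ K : Finset ℕ, K = (range L).filter fun k => k • d ∉ V ∧ z - k • d ∈ X :=
      ⟨_, rfl⟩
    have hKne : K.Nonempty :=
      ⟨k₀, by rw [hK, mem_filter, mem_range]; exact ⟨hk₀L, hk₀V, hk₀X⟩⟩
    obtain ⟨η, hηK, hmax⟩ := K.exists_max_image (fun k => k) hKne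
    rw [hK, mem_filter, mem_range] at hηK
    obtain ⟨hηL, hηV, hηX⟩ := hηK
    have hmax' : ∀ k, k < L → k • d ∉ V → z - k • d ∈ X → k ≤ η := fun k hk hkV hkX =>
      hmax k (by rw [hK, mem_filter, mem_range]; exact ⟨hk, hkV, hkX⟩)
    have hηL1 : η + 1 < L := by
      rcases lt_or_ge (η + 1) L with h | h
      · exact h
      · exfalso
        have : η = L - 1 := by omega
        rw [this] at hηV
        exact hηV hlast
    refine ⟨η, by rw [hH, mem_filter, mem_range]; exact ⟨hηL, hηV⟩, mem_inter.2 ⟨hηX, ?_⟩⟩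
    by_contra hxT
    rcases hT _ hxT with h1 | ⟨h1, h2⟩
    · -- the predecessor `z − (η+1) d` would lie in `X`
      have hx1 : z - (η + 1) • d ∈ X := by
        have e : z - η • d - d = z - (η + 1) • d := by rw [succ_nsmul]; abel
        rw [← e]; exact hTX _ h1
      by_cases hV1 : (η + 1) • d ∈ V
      · exact sub_not_mem_of_missing hz hV1 hx1
      · have := hmax' (η + 1) hηL1 hV1 hx1
        omega
    · -- the two successors `z − (η−1) d`, `z − (η−2) d` would lie in `X`
      have hη0 : 0 < η := by
        rcases Nat.eq_zero_or_pos η with h | h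
        · rw [h, zero_nsmul] at hηV; exact absurd h0 hηV
        · exact h
      obtain ⟨η', rfl⟩ : ∃ η', η = η' + 1 := ⟨η - 1, by omega⟩
      have hx1 : z - η' • d ∈ X := by
        have e : z - (η' + 1) • d + d = z - η' • d := by rw [succ_nsmul]; abel
        rw [← e]; exact hTX _ h1
      by_cases hV1 : η' • d ∈ V
      · exact sub_not_mem_of_missing hz hV1 hx1
      have hη'0 : 0 < η' := by
        rcases Nat.eq_zero_or_pos η' with h | h
        · rw [h, zero_nsmul] at hV1; exact absurd h0 hV1
        · exact h
      obtain ⟨η'', rfl⟩ : ∃ η'', η' = η'' + 1 := ⟨η' - 1, by omega⟩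
      have hx2 : z - η'' • d ∈ X := by
        have e : z - (η'' + 1 + 1) • d + 2 • d = z - η'' • d := by
          rw [succ_nsmul, succ_nsmul, two_nsmul]; abel
        rw [← e]; exact hTX _ h2
      by_cases hV2 : η'' • d ∈ V
      · exact sub_not_mem_of_missing hz hV2 hx2
      -- three holes `η'' < η'' + 1 < η'' + 2`: too many
      have h3 : ({η'', η'' + 1, η'' + 1 + 1} : Finset ℕ) ⊆ H := by
        intro k hk
        simp only [mem_insert, mem_singleton] at hk
        rw [hH, mem_filter, mem_range]
        rcases hk with rfl | rfl | rfl
        · exact ⟨by omega, hV2⟩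
        · exact ⟨by omega, hV1⟩
        · exact ⟨hηL, hηV⟩
      have := card_le_card h3
      rw [card_insert_of_notMem (by rw [mem_insert, mem_singleton]; omega),
        card_insert_of_notMem (by rw [mem_singleton]; omega), card_singleton] at this
      omega
  choose! g hgH hgXT using key
  calc #S ≤ #((X ∩ T) ×ˢ H) :=
        card_le_card_of_injOn (fun z => (z - g z • d, g z))
          (fun z hz => mem_product.2 ⟨hgXT z hz, hgH z hz⟩)
          (fun z₁ _ z₂ _ h => by
            have h2 : g z₁ = g z₂ := congrArg Prod.snd h
            have h1 : z₁ - g z₁ • d = z₂ - g z₂ • d := congrArg Prod.fst h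
            rw [h2] at h1
            exact sub_left_injective h1)
    _ = #(X ∩ T) * #H := card_product _ _
    _ ≤ #(X ∩ T) * 2 := Nat.mul_le_mul_left _ hcardH

/-- **Theorem 10, hull-normalised form.**  `V ⊆ {0, d, …, (L−1)d}` with `0, (L−1)d ∈ V`,
`L ≤ |V| + 2`, `|X| ≥ 5`, `|V| ≥ 4`, `|X + V| ≤ |X| + |V| + 1`, `|X + V| ≤ p − 5`, `p > 32`: then
`X` lies in a `d`-progression with `|X| + 2` terms.  Proof architecture: (Lemma 11) if `X` misses a
whole `(L−1)`-term `d`-run, rectify and use Lemma 9 (`subset_apFinset_of_short_runs`); otherwise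
every `(L−1)`-run meets `X` and (Lemmas 12–13, `false_of_runs_meet`) there are at most `10` missing
points and `L ≤ 16`; in that residual regime the set `S` of missing points and the reflection `N` of
`V` have `S + N` inside a translate of the complement of `X`, so `|S| + |N| − 1 ≤ |S + N| ≤
|S| + |N| + 1` (Cauchy–Davenport); Vosper's theorem, the Hamidoune–Rødseth theorem
(`Isoperimetric.hamidouneRodseth_inverse_theorem`) or — in the two-above case, the paper's «dual»
pair `(X', Y)` — Lemmas 11–13 applied to `(S, N)` put `S` in a short `d`-progression, which
contradicts `not_three_consecutive_missing` / `card_le_two_mul_card_inter`.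
[cite: HamidouneSerraZemor2006, Theorem 10 (§3, pp. 105–107)] -/
theorem compression_transfer_normalised (hp32 : 32 < p) {X V : Finset (ZMod p)} {d : ZMod p}
    (hd : d ≠ 0) {L : ℕ} (hV : V ⊆ apFinset 0 d L) (h0 : (0 : ZMod p) ∈ V)
    (hlast : (L - 1) • d ∈ V) (hLV : L ≤ #V + 2) (hX5 : 5 ≤ #X) (hV4 : 4 ≤ #V)
    (hXV : #(X + V) ≤ #X + #V + 1) (hXVp : #(X + V) + 5 ≤ p) :
    ∃ x : ZMod p, X ⊆ apFinset x d (#X + 2) := by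
  classical
  have hp37 : 37 ≤ p := by
    by_contra h
    have hpp := hp.out
    interval_cases p <;> norm_num at hpp
  have hXne : X.Nonempty := card_pos.1 (by omega)
  have hVL : #V ≤ L := (card_le_card hV).trans (card_apFinset_le _ _ _)
  have hVXV : #V ≤ #(X + V) := card_le_card_add_left hXne
  have hLp : L ≤ p := by omega
  have hXp : #X ≤ p := (card_le_univ X).trans_eq (ZMod.card p)
  -- Lemma 11: `X` misses a whole `(L−1)`-run, so the sum is a sum of integers
  by_cases hgap : ∃ c : ZMod p, ∀ x ∈ X, x ∉ apFinset c d (L - 1)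
  · obtain ⟨c, hc⟩ := hgap
    have hXrun : X ⊆ apFinset (c + (L - 1) • d) d (p - (L - 1)) := fun x hx =>
      mem_apFinset_of_not_mem hd (hc x hx)
    exact subset_apFinset_of_short_runs hd hXrun hV (by omega) (by omega) hV4
      (le_trans hX5 (le_max_left _ _)) hLV hXV
  push Not at hgap
  exfalso
  -- the missing points
  obtain ⟨S, hSdef⟩ : ∃ S : Finset (ZMod p), S = univ \ (X + V) := ⟨_, rfl⟩
  have hScard : #S = p - #(X + V) := by rw [hSdef, card_compl_eq]
  have hSmem : ∀ s ∈ S, s ∉ X + V := fun s hs => by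
    rw [hSdef] at hs
    exact (mem_sdiff.1 hs).2
  have hS5 : 5 ≤ #S := by omega
  obtain ⟨z, hzS⟩ : S.Nonempty := card_pos.1 (by omega)
  have hVL' : #V + 1 ≤ L := card_lt_of_runs_meet hd hLp hV hgap (hSmem z hzS)
  -- Lemmas 12–13: many missing points, or a long run
  by_cases hD : 11 ≤ #S ∨ (17 ≤ L ∧ 5 ≤ #S)
  · rw [hSdef] at hD
    exact false_of_runs_meet hd hLp hV h0 hlast hV4 hLV hgap hXV hD
  -- the residual regime
  have hS10 : #S ≤ 10 := by omega
  have hL16 : L ≤ 16 := by omega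
  have hX11 : 11 ≤ #X := by omega
  -- the reflection `N` of `V`
  obtain ⟨N, hN, h0N, hlastN, hNcard, hmemN⟩ := exists_reflection hV h0 hlast
  have hN4 : 4 ≤ #N := by omega
  have hLN : L ≤ #N + 2 := by omega
  have h2N : 2 * (#N + 2) ≤ p := by omega
  -- `S + N` lies in a translate of the complement of `X`
  have hSN : S + N ⊆ ((L - 1) • d) +ᵥ (univ \ X) := by
    intro x hx
    rw [mem_add] at hx
    obtain ⟨s, hs, n, hn, rfl⟩ := hx
    rw [mem_vadd_finset]
    refine ⟨s + n - (L - 1) • d, mem_sdiff.2 ⟨mem_univ _, fun hX => hSmem s hs ?_⟩, ?_⟩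
    · have := add_mem_add hX ((hmemN n).1 hn)
      rwa [show s + n - (L - 1) • d + ((L - 1) • d - n) = s by abel] at this
    · rw [vadd_eq_add]; abel
  have hcXc : #(((L - 1) • d) +ᵥ (univ \ X)) = p - #X := by rw [card_vadd_finset, card_compl_eq]
  have hSNcard : #(S + N) ≤ p - #X := by
    have := card_le_card hSN
    rwa [hcXc] at this
  have hSNne : S + N ≠ univ := by
    intro h
    have := hSNcard
    rw [h, card_univ, ZMod.card] at this
    omega
  have hCD := Vosper.cauchy_davenport_of_ne_univ (card_pos.1 (by omega : 0 < #S))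
    (card_pos.1 (by omega : 0 < #N)) hSNne
  -- `S` does not fit in a `(±d)`-progression with `|S| + 1` terms
  have hSrun : ∀ a e : ZMod p, (e = d ∨ e = -d) → S ⊆ apFinset a e (#S + 1) → False := by
    intro a e he haS
    obtain ⟨a', ha'⟩ : ∃ a' : ZMod p, S ⊆ apFinset a' d (#S + 1) := by
      rcases he with rfl | rfl
      · exact ⟨a, haS⟩
      · rw [Isoperimetric.apFinset_eq_apFinset_neg a (-d) (by omega : 1 ≤ #S + 1), neg_neg] at haS
        exact ⟨_, haS⟩
    obtain ⟨i, hi0, hi1, hi2⟩ := exists_three_terms hd (by omega) ha' le_rfl hS5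
    refine not_three_consecutive_missing hd hLp hV h0 hLV hgap (hSmem _ hi2) ?_ ?_
    · have e : a' + (i + 2) • d - d = a' + (i + 1) • d := by
        rw [add_nsmul, add_nsmul, two_nsmul, one_nsmul]; abel
      rw [e]; exact hSmem _ hi1
    · have e : a' + (i + 2) • d - 2 • d = a' + i • d := by rw [add_nsmul]; abel
      rw [e]; exact hSmem _ hi0
  obtain h | h | h : #(S + N) = #S + #N - 1 ∨ #(S + N) = #S + #N ∨ #(S + N) = #S + #N + 1 := by
    omega
  · -- Vosper's theorem: `S` and `N` are progressions with a common difference, which is `±d`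
    obtain ⟨e, he, ⟨a, ha⟩, ⟨b, hb⟩⟩ := vosper_inverse (by omega) (by omega) h (by omega)
    have hNb : N ⊆ apFinset b e (#N + 1) := fun x hx =>
      Rectification.apFinset_subset_apFinset_of_le b e (Nat.le_succ _)
        (hb.subst (motive := fun W => x ∈ W) hx)
    have hSa : S ⊆ apFinset a e (#S + 1) := fun x hx =>
      Rectification.apFinset_subset_apFinset_of_le a e (Nat.le_succ _)
        (ha.subst (motive := fun W => x ∈ W) hx)
    exact hSrun a e (eq_or_eq_neg_of_two_progressions hd he hN hNb hN4 hLN h2N (by omega)) hSa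
  · -- the Hamidoune–Rødseth theorem: `S`, `N` are almost-progressions with a common difference
    obtain ⟨e, a, b, he, haS, hbN⟩ :=
      Isoperimetric.hamidouneRodseth_inverse_theorem (A := S) (B := N) (by omega) (by omega)
        (by omega) h (by omega)
    exact hSrun a e (eq_or_eq_neg_of_two_progressions hd he hN hbN hN4 hLN h2N (by omega)) haS
  · -- two above: the pair `(S, N)` satisfies the hypotheses of the theorem, with `≥ 11` missing
    -- points (the translates of `X`)
    by_cases hgapS : ∃ c : ZMod p, ∀ s ∈ S, s ∉ apFinset c d (L - 1)
    · obtain ⟨c, hc⟩ := hgapS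
      have hSrun2 : S ⊆ apFinset (c + (L - 1) • d) d (p - (L - 1)) := fun s hs =>
        mem_apFinset_of_not_mem hd (hc s hs)
      obtain ⟨s₀, hs₀⟩ := subset_apFinset_of_short_runs hd hSrun2 hN (by omega) (by omega) hN4
        (le_trans hS5 (le_max_left _ _)) hLN h.le
      -- `S + N` IS the translate of the complement of `X`, which therefore lies in a progression
      have hSNeq : S + N = ((L - 1) • d) +ᵥ (univ \ X) :=
        eq_of_subset_of_card_le hSN (by rw [hcXc, h]; omega)
      obtain ⟨T, hT⟩ : ∃ T : Finset (ZMod p), T = apFinset (s₀ - (L - 1) • d) d (#S + 2 + L - 1) :=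
        ⟨_, rfl⟩
      have hXcT : univ \ X ⊆ T := by
        intro x hx
        have hx' : (L - 1) • d + x ∈ S + N := by
          rw [hSNeq]; exact mem_vadd_finset.2 ⟨x, hx, rfl⟩
        have := apFinset_add_apFinset_subset s₀ 0 d (#S + 2) L (add_subset_add hs₀ hN hx')
        rw [add_zero] at this
        obtain ⟨i, hi, hix⟩ := mem_apFinset.1 this
        rw [hT]
        refine mem_apFinset.2 ⟨i, hi, ?_⟩
        rw [sub_add_eq_add_sub, hix, add_sub_cancel_left]
      have hTX : ∀ x, x ∉ T → x ∈ X := fun x hxT => by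
        by_contra hxX
        exact hxT (hXcT (mem_sdiff.2 ⟨mem_univ _, hxX⟩))
      have hTstep : ∀ x, x ∉ T → x - d ∉ T ∨ (x + d ∉ T ∧ x + 2 • d ∉ T) := fun x hx => by
        rw [hT] at hx ⊢
        exact apFinset_compl_step hd (by omega) hx
      -- `|X ∩ T| ≤ 2`
      have hE : #(X ∩ T) ≤ 2 := by
        have h1 : #(X ∩ T) + #(X \ T) = #X := card_inter_add_card_sdiff X T
        have h2 : X \ T = univ \ T := by
          ext x
          simp only [mem_sdiff, mem_univ, true_and]
          exact ⟨fun h => h.2, fun h => ⟨hTX x h, h⟩⟩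
        have h3 : #(X \ T) = p - #T := by rw [h2, card_compl_eq]
        have h4 : #T ≤ #S + 2 + L - 1 := by rw [hT]; exact card_apFinset_le _ _ _
        omega
      have := card_le_two_mul_card_inter hd hLp hV h0 hlast hLV hgap hSmem hTX hTstep
      omega
    · push Not at hgapS
      refine false_of_runs_meet hd hLp hN h0N hlastN hN4 hLN hgapS h.le (Or.inl ?_)
      rw [card_compl_eq]
      omega

/-- **Theorem 10 (compression transfer)** of Hamidoune–Serra–Zémor: «Let `X`, `Y` be subsets of
`ℤ/pℤ` such that `|X + Y| = |X| + |Y| + 1 ≤ p − 5`, and with `|Y| ≥ 4`, `|X| ≥ 5`.  If `p > 32`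
then `ℓ_1(Y) ≤ |Y| + 2` implies `ℓ_1(X) ≤ |X| + 2`.»  Stated for an arbitrary difference `d ≠ 0`
in place of `1` (equivalent under the dilation by `d⁻¹`) and with `|X + Y| ≤ |X| + |Y| + 1` (the
cases of smaller sumset are covered by the same proof): if `Y` lies in a `d`-progression with
`|Y| + 2` terms then `X` lies in a `d`-progression with `|X| + 2` terms.  Reduction to the
hull-normalised form `compression_transfer_normalised` by shrinking the progression around `Y` to
its hull (`exists_tight_apFinset`) and translating.
[cite: HamidouneSerraZemor2006, Theorem 10 (§3, p. 105)] -/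
theorem compression_transfer (hp32 : 32 < p) {X Y : Finset (ZMod p)} {d y : ZMod p} (hd : d ≠ 0)
    (hX5 : 5 ≤ #X) (hY4 : 4 ≤ #Y) (hXY : #(X + Y) ≤ #X + #Y + 1) (hXYp : #(X + Y) + 5 ≤ p)
    (hYrun : Y ⊆ apFinset y d (#Y + 2)) : ∃ x : ZMod p, X ⊆ apFinset x d (#X + 2) := by
  classical
  have hYne : Y.Nonempty := card_pos.1 (by omega)
  obtain ⟨y', L, -, hLY, hYL, hy'Y, hlastY⟩ := exists_tight_apFinset hYne hYrun
  -- translate `Y` by `−y'`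
  obtain ⟨V, hVdef⟩ : ∃ V : Finset (ZMod p), V = Y + {-y'} := ⟨_, rfl⟩
  have hVcard : #V = #Y := by rw [hVdef, card_add_singleton]
  have hXVcard : #(X + V) = #(X + Y) := by rw [hVdef, ← add_assoc, card_add_singleton]
  have hmemV : ∀ v, v ∈ V ↔ v + y' ∈ Y := by
    intro v
    rw [hVdef, mem_add]
    constructor
    · rintro ⟨w, hw, t, ht, rfl⟩
      rw [mem_singleton] at ht
      subst ht
      rwa [neg_add_cancel_right]
    · intro h
      exact ⟨v + y', h, -y', mem_singleton_self _, by rw [add_neg_cancel_right]⟩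
  have hV : V ⊆ apFinset 0 d L := by
    intro v hv
    obtain ⟨i, hi, hiv⟩ := mem_apFinset.1 (hYL ((hmemV v).1 hv))
    refine mem_apFinset.2 ⟨i, hi, ?_⟩
    rw [add_comm] at hiv
    rw [zero_add]
    exact add_right_cancel hiv
  have h0 : (0 : ZMod p) ∈ V := (hmemV 0).2 (by rwa [zero_add])
  have hlast : (L - 1) • d ∈ V := (hmemV _).2 (by rwa [add_comm])
  exact compression_transfer_normalised hp32 hd hV h0 hlast (by omega) hX5 (by omega)
    (by rw [hXVcard]; omega) (by rw [hXVcard]; omega)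

end Assembly

end CompressionTransfer

end Literature.Combinatorics.Additive
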